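import Literature.Barriers.QuantumAdvantage.BoundedEntanglement
import Literature.Barriers.QuantumAdvantage.NoFreeFrame
import Literature.Barriers.QuantumAdvantage.NoFreeFrameCubeGraphFlatProofs
import Literature.Computability.Complexity.CodeFPArithExpr
import Literature.Computability.Cryptography.QuantumCircuit
import Literature.Computability.Cryptography.QuantumCircuitDescFP
import Literature.Computability.Cryptography.QubitRegister
import Literature.Computability.QuantumComplexity.CoreDescUniform
import Literature.Computability.QuantumComplexity.PauliExpansion
import Literature.Computability.QuantumComplexity.PauliParseval
import Literature.Computability.QuantumComplexity.RevTableau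
import Mathlib.Algebra.CharP.Algebra
import Mathlib.Algebra.CharP.Lemmas
import Mathlib.Analysis.Complex.Basic
import Mathlib.Analysis.SpecificLimits.Normed
import Mathlib.LinearAlgebra.UnitaryGroup
import Mathlib.RingTheory.AdjoinRoot
import Mathlib.RingTheory.Polynomial.Cyclotomic.Basic
import Mathlib.RingTheory.Polynomial.Cyclotomic.Factorization
import HarnessLib

/-!
# `noFreeFrame` holds: no free frame (`¬ H_FF`) — the cube-map witness family defeats every Clifford frame

Barrier catalogue `Literature/Barriers/QuantumAdvantage/` (D-0021). Proofs and private plumbing definitions only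
(no named facts): the discharge of the named fact `Literature.Barriers.QuantumAdvantage.noFreeFrame` of
`NoFreeFrame.lean`. It is FALSE that every polynomial-time uniform, oracle-free Clifford+T family `F` admits an
exponent `c` such that, for every input `x` and every stage `j`, some unitary normalising the Pauli group up to unit
phases (a semantic Clifford frame) makes EVERY linear cut `{wires < k}` of `U · (F.stateAfter x j)` have purity
`≥ 1/(|x|^c + c)`. Witness: the family loading `Σ_y |y⟩` and computing `y ↦ y³` in `𝔽₂[X]/(Φ_{3^{k+1}})`,
`n = |x| = 2·3^k`, on input `0ⁿ`, final stage: every Clifford frame has a cut of purity `≤ 5·2^{−n/2}` (flatness of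
the cube graph state, `cubeGraphFlat_holds` of `NoFreeFrameCubeGraphFlatProofs.lean`, and the ancilla-free purity
bound of section `Purity`), which is eventually `< 1/(n^c + c)`.

PROVENANCE. The barrier docstring of `noFreeFrame` records that this statement was machine-checked in the tree as
`Summit.QuantumAdvantage.QuantumAdvantage.Theorems.SymplecticPurity.noFreeFrame_proof` (item stmt-QuantumAdvantage-10731
of the retired route `SymplecticPurity`), with a body definitionally equal to the Literature `def`; `Literature` cannot
import `Summits`, so the proof — the files
`Summits/QuantumAdvantage/QuantumAdvantage/Theorems/SymplecticPurity{Defs,NoFreeFrameFamily,NoFreeFrameCyclo,NoFreeFrameUniform,NoFreeFramePurity,NoFreeFrameCoord,NoFreeFrame}.lean`,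
which use only Mathlib and `Literature.Computability.*` / `Literature.Barriers.QuantumAdvantage.BoundedEntanglement` — is
carried over here verbatim, one `section` per source file, as PRIVATE helper lemmas and PRIVATE plumbing definitions
(the witness family `cubeFamily`, its gate lists, `cubePoly = Φ_{3^{k+1}}`, `cubeEquiv`; no instance, no notation:
the source's three `local notation`s are spelled out) in the sub-namespace `…QuantumAdvantage.NoFreeFrameKill`, with
the route's `CubeGraphFlat_proof` replaced by the Literature discharge `cubeGraphFlat_holds`, and closed as
`noFreeFrame_holds`.

## References

* [LiuClark2024] (as cited by `NoFreeFrame.lean`) — Clifford-augmented matrix product states / the free-frame road.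
* [AaronsonGottesman2004] S. Aaronson, D. Gottesman, *Improved simulation of stabilizer circuits*, Phys. Rev. A 70
  (2004), 052328.
* [Gold1968] R. Gold, IEEE Trans. Inform. Theory 14 (1968), 154–156; [Nyberg1994] K. Nyberg, EUROCRYPT '93, LNCS 765.
-/

noncomputable section

namespace Literature.Barriers.QuantumAdvantage

namespace NoFreeFrameKill

section Defs

/-! ### Source `Summits/QuantumAdvantage/QuantumAdvantage/Theorems/SymplecticPurityDefs.lean` — shared definitions: purity sums, the cube witness family `cubeFamily`, the field `𝔽₂[X]/(Φ_{3^{k+1}})`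

Original module docstring:

# Route `SymplecticPurity` — route-posited objects for item `NoFreeFrame` (stmt-QuantumAdvantage-10731)

D-0016 `<Route>Defs` file. NOTHING IS ASSERTED here beyond two bookkeeping lemmas (wire bounds and
well-formedness of the witness program, needed to *type* the circuit). Objects:

* `puritySum k φ` — the 4-fold agreement sum of the route's items (`Tr ρ_{<k}²` on amplitudes,
  verbatim the summand of `SymplecticPurityBound` / `NoFreeFrame`), `pauliExp S φ = ⟨φ|σ_S|φ⟩`,
  `cutSet N k = {wires < k}`;
* the WITNESS FAMILY of `NoFreeFrame` (the planner's `F_n`, made ancilla-free): on input length `n`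
  with `n` ancillas, a Hadamard on every input wire, then the compiled (`revCompile`, Toffoli = exact
  Clifford+T word) reversible program `cubeOpsA n` writing the coordinates of `y ↦ y³` computed in
  `𝔽₂[X]/(X^{2h} + X^h + 1)`, `h = n / 2`, into the ancilla register WITHOUT scratch wires:
  `y³ = y · y²` and `y²` is `𝔽₂`-linear, so bit `l` of `y³` is the parity
  `Σ_i y_i [l ∈ E(3i)] + Σ_{i ≠ j} y_i y_j [l ∈ E(i + 2j)]`, `E(m) = cubeExps h m` the exponents of
  `X^m mod (X^{2h} + X^h + 1)` (`X^{3h} = 1`, `X^{2h} = X^h + 1`); one `CNOT`/Toffoli per term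
  (`cubeOpsA`, `cubeGates`, `cubeCirc`, `cubeFamily`);
* the good input lengths `n = 2·3^k`: `cubePoly k = Φ_{3^{k+1}} = X^{2·3^k} + X^{3^k} + 1 ∈ 𝔽₂[X]`,
  the ring `AdjoinRoot (cubePoly k)` (a field of order `2^{2·3^k}`, proved in the sequel files) and its
  coordinate identification `cubeEquiv k : AdjoinRoot (cubePoly k) ≃+ (Fin (2·3^k) → ZMod 2)` in the
  power basis `1, α, …, α^{2·3^k − 1}` (the `e` of the route's `CubeGraphFlat`).

References: the route file `Theses/SymplecticPurity.lean` (items `NoFreeFrame`, `CubeGraphFlat`,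
`SymplecticPurityBound`); R. Lidl, H. Niederreiter, *Finite Fields* (1997), Thm. 2.47(ii) and
Ex. 2.48 (irreducibility of `Φ_{3^{k+1}}` over `𝔽₂`); Nielsen–Chuang §4.3 (Toffoli in Clifford+T).
-/

open Literature.Computability.QuantumComplexity Literature.Computability.Cryptography

/-! ### Purity of a linear cut, Pauli expectations -/

variable {N : ℕ}

/-- The 4-fold agreement sum of the route files: `Tr ρ_A²` for `A = {wires < k}`, written on the
amplitudes of `φ` (for a unit vector; in general homogeneous of degree 4 in `φ`).
[folklore] -/
private def puritySum (k : ℕ) (φ : QReg N → ℂ) : ℂ :=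
  ∑ x₁ : QReg N, ∑ x₂ : QReg N, ∑ x₃ : QReg N, ∑ x₄ : QReg N,
    (if (∀ i, k ≤ i.val → x₁ i = x₂ i) ∧ (∀ i, i.val < k → x₂ i = x₃ i) ∧
        (∀ i, k ≤ i.val → x₃ i = x₄ i) ∧ (∀ i, i.val < k → x₄ i = x₁ i) then
      φ x₁ * star (φ x₂) * φ x₃ * star (φ x₄) else 0)

/-- The (unnormalised) Pauli expectation `⟨φ|σ_S|φ⟩`. [folklore] -/
private def pauliExp (S : Fin N → Pauli) (φ : QReg N → ℂ) : ℂ :=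
  star φ ⬝ᵥ (pauliString S).mulVec φ

/-- The wire set `{i : i < k}` of a linear cut. [folklore] -/
private def cutSet (N k : ℕ) : Finset (Fin N) := Finset.univ.filter fun i : Fin N => i.val < k

/-! ### The witness family -/

/-- The exponents of `X^m` reduced modulo `X^{2h} + X^h + 1` over `𝔽₂` (using `X^{3h} = 1` and
`X^{2h} = X^h + 1`): `[m mod 3h]` if that is `< 2h`, else `[m mod 3h − h, m mod 3h − 2h]`; the empty
list in the degenerate case `h = 0` (input lengths `n ≤ 1`, never used).
[folklore] -/
private def cubeExps (h m : ℕ) : List ℕ :=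
  if h = 0 then [] else
    if m % (3 * h) < 2 * h then [m % (3 * h)] else [m % (3 * h) - h, m % (3 * h) - 2 * h]

/-- The linear part of the cube program on input length `n` (`h = n / 2`): one `CNOT` from input
wire `i` onto ancilla wire `n + l` for every `l ∈ cubeExps h (3i)` (the terms `y_i X^{3i}`).
[folklore] -/
private def cubeLinOps (n : ℕ) : List (ClOp ℕ) :=
  (List.range n).flatMap fun i => (cubeExps (n / 2) (3 * i)).map fun l => ClOp.cnot i (n + l)

/-- The quadratic part: one Toffoli with controls `i ≠ j` onto ancilla wire `n + l` for every
`l ∈ cubeExps h (i + 2j)` (the terms `y_i y_j X^{i + 2j}`).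
[folklore] -/
private def cubeQuadOps (n : ℕ) : List (ClOp ℕ) :=
  (List.range n).flatMap fun i => (List.range n).flatMap fun j =>
    if i = j then [] else (cubeExps (n / 2) (i + 2 * j)).map fun l => ClOp.toffoli i j (n + l)

/-- The cube program on `ℕ`-indexed wires: input register `0 … n-1`, ancilla register
`n … 2n-1`.
[folklore] -/
private def cubeOpsA (n : ℕ) : List (ClOp ℕ) := cubeLinOps n ++ cubeQuadOps n

/-- Every exponent produced by `cubeExps h m` is `< 2h`. [folklore] -/
private theorem lt_of_mem_cubeExps {h m l : ℕ} (hl : l ∈ cubeExps h m) : l < 2 * h := by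
  unfold cubeExps at hl
  split_ifs at hl with hh hlt
  · simp at hl
  · rw [List.mem_singleton] at hl; omega
  · simp only [List.mem_cons, List.not_mem_nil, or_false] at hl
    have hpos : 0 < 3 * h := by omega
    have := Nat.mod_lt m hpos
    omega

/-- All wires of the cube program are `< n + n`. [folklore] -/
private theorem cubeOpsA_wires {n : ℕ} : ∀ op ∈ cubeOpsA n, ∀ i ∈ RevSim.wiresOf op, i < n + n := by
  intro op hop i hi
  simp only [cubeOpsA, cubeLinOps, cubeQuadOps, List.mem_append, List.mem_flatMap, List.mem_map,
    List.mem_range] at hop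
  rcases hop with ⟨a, ha, l, hl, rfl⟩ | ⟨a, ha, b, hb, hop⟩
  · have := lt_of_mem_cubeExps hl
    simp only [RevSim.mem_wiresOf, ClOp.target, ClOp.controls, List.mem_singleton] at hi
    omega
  · split_ifs at hop with hab
    · simp at hop
    · rw [List.mem_map] at hop
      obtain ⟨l, hl, rfl⟩ := hop
      have := lt_of_mem_cubeExps hl
      simp only [RevSim.mem_wiresOf, ClOp.target, ClOp.controls, List.mem_cons,
        List.not_mem_nil, or_false] at hi
      omega

/-- The cube program is well formed (each gate acts on pairwise distinct wires). [folklore] -/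
private theorem cubeOpsA_wf {n : ℕ} : ∀ op ∈ cubeOpsA n, op.WF := by
  intro op hop
  simp only [cubeOpsA, cubeLinOps, cubeQuadOps, List.mem_append, List.mem_flatMap, List.mem_map,
    List.mem_range] at hop
  rcases hop with ⟨a, ha, l, -, rfl⟩ | ⟨a, ha, b, hb, hop⟩
  · show a ≠ n + l; omega
  · split_ifs at hop with hab
    · simp at hop
    · rw [List.mem_map] at hop
      obtain ⟨l, -, rfl⟩ := hop
      show a ≠ b ∧ a ≠ n + l ∧ b ≠ n + l; omega

/-- The cube program transported to `Fin (n + n)`-indexed wires (reduction mod `n + n`, the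
identity on its wires).
[folklore] -/
private def cubeOpsFin (n : ℕ) (hn : 0 < n + n) : List (ClOp (Fin (n + n))) :=
  (cubeOpsA n).map (ClOp.map (RevSim.finOf (n + n) hn))

/-- The transported program is well formed. [folklore] -/
private theorem cubeOpsFin_wf (n : ℕ) (hn : 0 < n + n) : ∀ op ∈ cubeOpsFin n hn, op.WF := by
  intro op hop
  obtain ⟨op', hop', rfl⟩ := List.mem_map.1 hop
  exact RevSim.wf_map_finOf hn (cubeOpsA_wires op' hop') (cubeOpsA_wf op' hop')

/-- The gates of the witness circuit on input length `n`: a Hadamard on each input wire, then the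
compiled cube program (empty for `n = 0`).
[folklore] -/
private def cubeGates (n : ℕ) : List (QGate cliffordT (n + n)) :=
  if hn : 0 < n + n then
    (List.finRange n).map (fun i => hOn (Fin.castAdd n i)) ++
      revCompile (toRevList (cubeOpsFin n hn) (cubeOpsFin_wf n hn))
  else []

/-- The witness circuit on input length `n` (`n` input wires, `n` ancillas). [folklore] -/
private def cubeCirc (n : ℕ) : QCircuit cliffordT (n + n) := ⟨cubeGates n⟩

/-- The Boolean map computed by the cube program into the ancilla register: bit `l` of the ancilla
register after running `cubeOpsA n` on `|y⟩|0ⁿ⟩` (for `n = 2·3^k` these are the coordinates of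
`y³` in `𝔽₂[X]/(Φ_{3^{k+1}})`, proved in the sequel files).
[folklore] -/
private def cubeMap (n : ℕ) (y : Fin n → Bool) : Fin n → Bool :=
  fun l => clEval (cubeOpsA n) (RevSim.liftW (padInput y n)) (n + l)

/-- **The witness family of `NoFreeFrame`**: `n` ancillas on inputs of length `n`; on the input
`0ⁿ` its final state is the normalised graph state `2^{-n/2} Σ_y |y⟩|y³⟩` of the cube map of
`𝔽₂[X]/(X^{2h} + X^h + 1)`, `h = n/2` — a field for `n = 2·3^k`.
[folklore] -/
private def cubeFamily : QCircuitFamily cliffordT :=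
  ⟨fun n => n, cubeCirc⟩

/-! ### The good input lengths: the fields `𝔽₂[X]/(Φ_{3^{k+1}})` -/

/-- `Φ_{3^{k+1}} = X^{2·3^k} + X^{3^k} + 1 ∈ 𝔽₂[X]`. [folklore] -/
private abbrev cubePoly (k : ℕ) : Polynomial (ZMod 2) := Polynomial.cyclotomic (3 ^ (k + 1)) (ZMod 2)

/-- `deg Φ_{3^{k+1}} = 2·3^k`. [folklore] -/
private theorem natDegree_cubePoly (k : ℕ) : (cubePoly k).natDegree = 2 * 3 ^ k := by
  rw [Polynomial.natDegree_cyclotomic, Nat.totient_prime_pow Nat.prime_three (Nat.succ_pos k)]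
  simp [mul_comm]

/-- The power basis `1, α, …, α^{2·3^k − 1}` of `𝔽₂[X]/(Φ_{3^{k+1}})`, indexed by `Fin (2·3^k)`. [folklore] -/
private def cubeBasis (k : ℕ) : Module.Basis (Fin (2 * 3 ^ k)) (ZMod 2) (AdjoinRoot (cubePoly k)) :=
  ((AdjoinRoot.powerBasis' (Polynomial.cyclotomic.monic _ _)).basis).reindex
    (finCongr (by rw [AdjoinRoot.powerBasis'_dim, natDegree_cubePoly]))

/-- The coordinate identification `e : 𝔽₂[X]/(Φ_{3^{k+1}}) ≃+ 𝔽₂^{2·3^k}` in the power basis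
(additive, i.e. `𝔽₂`-linear, as `CubeGraphFlat` requires).
[folklore] -/
private def cubeEquiv (k : ℕ) : AdjoinRoot (cubePoly k) ≃+ (Fin (2 * 3 ^ k) → ZMod 2) :=
  (cubeBasis k).equivFun.toAddEquiv

end Defs

section Family

/-! ### Source `Summits/QuantumAdvantage/QuantumAdvantage/Theorems/SymplecticPurityNoFreeFrameFamily.lean` — the witness family: gates, final state `|x⟩ ⊗ ĝ ⊗ |0…0⟩`, oracle-freeness

Original module docstring:

# Route `SymplecticPurity`, item `NoFreeFrame` — the final state of the witness family

On the all-zero input of length `n ≥ 1` the witness family `cubeFamily` ends (after all its gates) in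
the normalised graph state of the Boolean map `cubeMap n` computed by its reversible part:

  `cubeFamily.stateAfter 0ⁿ (size) = z ↦ [z|ancillas = cubeMap n (z|inputs)] · 2^{-n/2}`.

Ingredients: the Hadamard layer on the input wires (`hadamards_mulVec_basisState`), the exact classical
action of compiled reversible programs (`revCompile_mulVec_basisState`, `revEval_toRevList`,
`RevSim.clEval_map_finOf_apply`) and the invariance of the input register under `cubeOpsA n` (its
targets are ancilla wires).
-/

open _root_.Matrix
open Literature.Computability.QuantumComplexity Literature.Computability.Cryptography

/-! ### The input register is untouched -/

/-- Every target of the cube program is an ancilla wire (`≥ n`). [folklore] -/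
private theorem le_target_of_mem_cubeOpsA {n : ℕ} {op : ClOp ℕ} (hop : op ∈ cubeOpsA n) : n ≤ op.target := by
  simp only [cubeOpsA, cubeLinOps, cubeQuadOps, List.mem_append, List.mem_flatMap, List.mem_map,
    List.mem_range] at hop
  rcases hop with ⟨a, -, l, -, rfl⟩ | ⟨a, -, b, -, hop⟩
  · show n ≤ n + l; omega
  · split_ifs at hop
    · simp at hop
    · rw [List.mem_map] at hop
      obtain ⟨l, -, rfl⟩ := hop
      show n ≤ n + l; omega

/-- The cube program does not change the input register. [folklore] -/
private theorem clEval_cubeOpsA_of_lt {n : ℕ} (w : ℕ → Bool) {i : ℕ} (hi : i < n) :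
    clEval (cubeOpsA n) w i = w i :=
  clEval_apply_of_forall_target_ne _ _ fun op hop h => by
    have := le_target_of_mem_cubeOpsA hop; omega

/-! ### The classical action of the transported program -/

section Fin

variable {n : ℕ} (hn : 0 < n + n)

/-- On `Fin (n + n)` wires: the input register is untouched. [folklore] -/
private theorem clEval_cubeOpsFin_castAdd (w : QReg (n + n)) (i : Fin n) :
    clEval (cubeOpsFin n hn) w (Fin.castAdd n i) = w (Fin.castAdd n i) := by
  rw [cubeOpsFin, RevSim.clEval_map_finOf_apply hn _ cubeOpsA_wires, Fin.val_castAdd,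
    clEval_cubeOpsA_of_lt _ i.isLt]
  exact RevSim.liftW_val w (Fin.castAdd n i)

/-- On `Fin (n + n)` wires, started on `|y⟩|0ⁿ⟩`: the ancilla register ends in `cubeMap n y`. [folklore] -/
private theorem clEval_cubeOpsFin_natAdd (y : QReg n) (l : Fin n) :
    clEval (cubeOpsFin n hn) (padInput y n) (Fin.natAdd n l) = cubeMap n y l := by
  rw [cubeOpsFin, RevSim.clEval_map_finOf_apply hn _ cubeOpsA_wires, Fin.val_natAdd]
  rfl

/-- The transported program maps `|y⟩|0ⁿ⟩` to `|y⟩|cubeMap n y⟩`. [folklore] -/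
private theorem clEval_cubeOpsFin_padInput (y : QReg n) :
    clEval (cubeOpsFin n hn) (padInput y n) = Fin.append y (cubeMap n y) := by
  funext p
  refine Fin.addCases (fun i => ?_) (fun l => ?_) p
  · rw [clEval_cubeOpsFin_castAdd, Fin.append_left]
    show Fin.append y (fun _ => false) (Fin.castAdd n i) = y i
    rw [Fin.append_left]
  · rw [clEval_cubeOpsFin_natAdd, Fin.append_right]

end Fin

/-! ### The final state -/

/-- A register label as the append of its two halves. [folklore] -/
private theorem append_halves {n : ℕ} (z : QReg (n + n)) :
    Fin.append (fun i => z (Fin.castAdd n i)) (fun l => z (Fin.natAdd n l)) = z :=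
  Fin.append_castAdd_natAdd

/-- The padded all-zero input is the all-zero label. [folklore] -/
private theorem padInput_get_eq_false (x : List Bool) (hx : ∀ i, x.get i = false) (m : ℕ)
    (i : Fin (x.length + m)) : padInput x.get m i = false := by
  unfold padInput
  induction i using Fin.addCases with
  | left i => rw [Fin.append_left]; exact hx i
  | right i => rw [Fin.append_right]

/-- **The final state of the witness family on `0ⁿ`** (`n ≥ 1`): the normalised graph state of
`cubeMap n`, i.e. amplitude `2^{-n/2}` on the labels `|y⟩|cubeMap n y⟩` and `0` elsewhere.
[folklore] -/
private theorem cubeFamily_stateAfter (x : List Bool) (hx : ∀ i, x.get i = false) (hn : 0 < x.length) :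
    cubeFamily.stateAfter x (cubeGates x.length).length = fun z : QReg (x.length + x.length) =>
      if (fun l => z (Fin.natAdd x.length l)) = cubeMap x.length (fun i => z (Fin.castAdd x.length i))
      then invSqrt2 ^ x.length else 0 := by
  set n := x.length with hndef
  have hnn : 0 < n + n := by omega
  -- the circuit, with the `dite` resolved
  have hgates : cubeGates n = (List.finRange n).map (fun i => hOn (Fin.castAdd n i)) ++
      revCompile (toRevList (cubeOpsFin n hnn) (cubeOpsFin_wf n hnn)) := by
    simp [cubeGates, hnn]
  -- unfold `stateAfter`: all gates are applied
  show QCircuit.runOn 0 (⟨(cubeGates n).take (cubeGates n).length⟩ : QCircuit cliffordT (n + n))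
      (basisState (padInput x.get n)) = _
  have htake : (cubeGates n).take (cubeGates n).length = cubeGates n := List.take_length
  rw [htake, hgates, show (⟨(List.finRange n).map (fun i => hOn (Fin.castAdd n i)) ++
      revCompile (toRevList (cubeOpsFin n hnn) (cubeOpsFin_wf n hnn))⟩ : QCircuit cliffordT (n + n)) =
      (⟨(List.finRange n).map (fun i => hOn (Fin.castAdd n i))⟩ : QCircuit cliffordT (n + n)).append
        ⟨revCompile (toRevList (cubeOpsFin n hnn) (cubeOpsFin_wf n hnn))⟩ from rfl,
    QCircuit.runOn, QCircuit.toMatrix_append, ← Matrix.mulVec_mulVec]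
  -- the Hadamard layer
  have hws : ((List.finRange n).map (Fin.castAdd n)).Nodup :=
    (List.nodup_finRange n).map (Fin.castAdd_injective n n)
  have h0 : ∀ i, padInput x.get n i = false := padInput_get_eq_false x hx n
  have hH := hadamards_mulVec_basisState ((List.finRange n).map (Fin.castAdd n)) hws
    (padInput x.get n) (fun i _ => h0 i)
  rw [List.map_map] at hH
  rw [show (fun i => hOn (Fin.castAdd n i)) = hOn ∘ Fin.castAdd n from rfl, hH, List.length_map,
    List.length_finRange]
  -- the reversible part, entrywise
  funext z
  set A := QCircuit.toMatrix 0
    (⟨revCompile (toRevList (cubeOpsFin n hnn) (cubeOpsFin_wf n hnn))⟩ : QCircuit cliffordT (n + n))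
    with hAdef
  set F : QReg (n + n) → QReg (n + n) := clEval (cubeOpsFin n hnn) with hFdef
  -- columns of `A`: `A |z'⟩ = |F z'⟩`
  have hcol : ∀ z' : QReg (n + n), A z z' = if z = F z' then 1 else 0 := by
    intro z'
    have : A z z' = (A *ᵥ basisState z') z := by rw [mulVec_basisState]
    rw [this, hAdef, revCompile_mulVec_basisState, revEval_toRevList, basisState_apply]
  -- the vector after the Hadamard layer, rewritten on the ancilla register
  have hanc : ∀ z' : QReg (n + n), (∀ j, j ∉ (List.finRange n).map (Fin.castAdd n) →
      z' j = padInput x.get n j) ↔ (fun l => z' (Fin.natAdd n l)) = fun _ => false := by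
    intro z'
    constructor
    · intro h
      funext l
      rw [h _ (fun hm => ?_), h0]
      obtain ⟨i, -, hi⟩ := List.mem_map.1 hm
      have := congrArg Fin.val hi
      simp at this
      omega
    · intro h j hj
      rw [h0]
      induction j using Fin.addCases with
      | left i => exact absurd (List.mem_map.2 ⟨i, List.mem_finRange i, rfl⟩) hj
      | right l => exact congrFun h l
  simp only [Matrix.mulVec, dotProduct, hcol, hanc]
  -- only `z₀ = |z.inputs⟩|0ⁿ⟩` contributes
  set y : QReg n := fun i => z (Fin.castAdd n i) with hydef
  have hFpad : F (padInput y n) = Fin.append y (cubeMap n y) := clEval_cubeOpsFin_padInput hnn y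
  rw [Finset.sum_eq_single (padInput y n)]
  · -- the value at `z₀`
    have hz0 : (fun l => padInput y n (Fin.natAdd n l)) = fun _ => false := by
      funext l; exact Fin.append_right _ _ _
    rw [if_pos hz0, hFpad]
    by_cases h : (fun l => z (Fin.natAdd n l)) = cubeMap n y
    · rw [if_pos h, if_pos, one_mul]
      rw [← append_halves z, h]
    · rw [if_neg h, if_neg, zero_mul]
      intro h'
      apply h
      funext l
      have := congrFun h' (Fin.natAdd n l)
      rwa [Fin.append_right] at this
  · -- every other `z'` contributes `0`
    intro z' _ hne
    by_cases hz' : (fun l => z' (Fin.natAdd n l)) = fun _ => false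
    · rw [if_pos hz', if_neg, zero_mul]
      intro hzF
      apply hne
      have e : z' = padInput (fun i => z' (Fin.castAdd n i)) n := by
        conv_lhs => rw [← append_halves z']
        rw [hz']; rfl
      have hy : (fun i => z' (Fin.castAdd n i)) = y := by
        funext i
        have := congrFun hzF (Fin.castAdd n i)
        rw [e, hFdef, clEval_cubeOpsFin_padInput hnn, Fin.append_left] at this
        exact this.symm
      rw [e, hy]
    · rw [if_neg hz', mul_zero]
  · exact fun h => absurd (Finset.mem_univ _) h

end Family

section Cyclo

/-! ### Source `Summits/QuantumAdvantage/QuantumAdvantage/Theorems/SymplecticPurityNoFreeFrameCyclo.lean` — irreducibility of `Φ_{3^{k+1}}` over `𝔽₂` (2 is a primitive root mod `3^{k+1}`)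

Original module docstring:

# Route `SymplecticPurity`, item `NoFreeFrame` — `Φ_{3^{k+1}}` is irreducible over `𝔽₂`

The good input lengths of the witness family are `n = 2·3^k`, where the modulus
`X^{2·3^k} + X^{3^k} + 1 = Φ_{3^{k+1}}` of its arithmetic is irreducible over `𝔽₂`
(Lidl–Niederreiter, *Finite Fields*, Thm. 2.47(ii) with Ex. 2.48: `Φ_m` is irreducible over `𝔽_q`
iff `q` is a primitive root mod `m`; and `2` is a primitive root modulo every power of `3`). In Mathlib
terms (`ZMod.irreducible_of_dvd_cyclotomic_of_natDegree`) this is the computation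
`ord_{3^{k+1}}(2) = 2·3^k`, done here by hand: `2^{3^k} ≡ 2 (mod 3)` excludes the divisor `3^k` of
the order, and the lifting-the-exponent congruence `4^{3^j} = 1 + 3^{j+1}·t`, `3 ∤ t`, excludes
`2·3^{k-1}`. Consequences: `AdjoinRoot (cubePoly k)` is a field with `2^{2·3^k}` elements.
-/

open _root_.Polynomial

/-! ### `ord_{3^{k+1}}(2) = 2·3^k` -/

/-- Lifting the exponent at `3`: `4^{3^j} = 1 + 3^{j+1} t` with `3 ∤ t`. [folklore] -/
private theorem four_pow_three_pow (j : ℕ) : ∃ t : ℕ, 4 ^ 3 ^ j = 1 + 3 ^ (j + 1) * t ∧ ¬ 3 ∣ t := by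
  induction j with
  | zero => exact ⟨1, by norm_num, by norm_num⟩
  | succ j ih =>
    obtain ⟨t, ht, h3⟩ := ih
    refine ⟨t + 3 * (3 ^ j * t ^ 2 + 3 ^ (2 * j) * t ^ 3), ?_, ?_⟩
    · rw [pow_succ, pow_mul, ht]; ring
    · omega

/-- `3^{k+1} ∤ 4^{3^{k-1}} − 1` for `k ≥ 1`. [folklore] -/
private theorem not_dvd_four_pow_sub_one {k : ℕ} (hk : 1 ≤ k) : ¬ 3 ^ (k + 1) ∣ 4 ^ 3 ^ (k - 1) - 1 := by
  obtain ⟨t, ht, h3⟩ := four_pow_three_pow (k - 1)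
  rw [ht, Nat.add_sub_cancel_left, show k - 1 + 1 = k by omega]
  rintro ⟨c, hc⟩
  apply h3
  refine ⟨c, ?_⟩
  have h3k : 0 < 3 ^ k := pow_pos (by norm_num) k
  rw [pow_succ, mul_assoc] at hc
  exact Nat.eq_of_mul_eq_mul_left h3k hc

/-- `2` is coprime to `3^{k+1}`. [folklore] -/
private theorem coprime_two_three_pow (k : ℕ) : Nat.Coprime 2 (3 ^ (k + 1)) :=
  Nat.Coprime.pow_right _ (by norm_num)

/-- `2^{3^k} ≠ 1` in `ZMod 3^{k+1}` (it is `≡ 2 mod 3`). [folklore] -/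
private theorem two_pow_three_pow_ne_one (k : ℕ) : ((2 : ℕ) : ZMod (3 ^ (k + 1))) ^ 3 ^ k ≠ 1 := by
  intro h
  have h3 : 3 ∣ 3 ^ (k + 1) := dvd_pow_self 3 (Nat.succ_ne_zero k)
  have hc := congrArg (ZMod.castHom h3 (ZMod 3)) h
  rw [map_pow, map_natCast, map_one] at hc
  -- in `ZMod 3`: `2 ^ 3^k = 2`
  have hodd : Odd (3 ^ k) := Odd.pow (by decide)
  obtain ⟨m, hm⟩ := hodd
  rw [hm, pow_succ, pow_mul] at hc
  have h4 : ((2 : ℕ) : ZMod 3) ^ 2 = 1 := by decide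
  rw [h4, one_pow, one_mul] at hc
  exact absurd hc (by decide)

/-- `2^{2·3^{k-1}} ≠ 1` in `ZMod 3^{k+1}` for `k ≥ 1` (lifting the exponent). [folklore] -/
private theorem two_pow_two_mul_three_pow_ne_one {k : ℕ} (hk : 1 ≤ k) :
    ((2 : ℕ) : ZMod (3 ^ (k + 1))) ^ (2 * 3 ^ (k - 1)) ≠ 1 := by
  intro h
  have h' : ((4 ^ 3 ^ (k - 1) : ℕ) : ZMod (3 ^ (k + 1))) = ((1 : ℕ) : ZMod (3 ^ (k + 1))) := by
    rw [show (4 : ℕ) = 2 ^ 2 by norm_num, ← pow_mul, Nat.cast_pow, Nat.cast_one]; exact h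
  rw [ZMod.natCast_eq_natCast_iff, Nat.ModEq.comm,
    Nat.modEq_iff_dvd' (Nat.one_le_pow _ _ (by norm_num))] at h'
  exact not_dvd_four_pow_sub_one hk h'

/-- **`2` is a primitive root modulo `3^{k+1}`**: `ord_{3^{k+1}}(2) = 2·3^k = φ(3^{k+1})`. [folklore] -/
private theorem orderOf_two_mod_three_pow (k : ℕ) :
    orderOf (ZMod.unitOfCoprime 2 (coprime_two_three_pow k)) = 2 * 3 ^ k := by
  have hne : NeZero (3 ^ (k + 1)) := ⟨pow_ne_zero _ (by norm_num)⟩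
  refine orderOf_eq_of_pow_and_pow_div_prime (by positivity) ?_ ?_
  · have := ZMod.pow_totient (ZMod.unitOfCoprime 2 (coprime_two_three_pow k))
    rw [Nat.totient_prime_pow Nat.prime_three (by omega : 0 < k + 1)] at this
    simpa [mul_comm] using this
  · intro p hp hpd
    have hval : ∀ m : ℕ, (ZMod.unitOfCoprime 2 (coprime_two_three_pow k)) ^ m ≠ 1 ↔
        ((2 : ℕ) : ZMod (3 ^ (k + 1))) ^ m ≠ 1 := fun m => by
      rw [Ne, Ne, Units.ext_iff, Units.val_pow_eq_pow_val, ZMod.coe_unitOfCoprime, Units.val_one]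
    rw [hval]
    -- `p = 2` or `p = 3`
    have hp23 : p = 2 ∨ p = 3 := by
      rcases (Nat.Prime.dvd_mul hp).1 hpd with h2 | h3
      · exact Or.inl ((Nat.prime_dvd_prime_iff_eq hp Nat.prime_two).1 h2)
      · exact Or.inr ((Nat.prime_dvd_prime_iff_eq hp Nat.prime_three).1 (hp.dvd_of_dvd_pow h3))
    rcases hp23 with rfl | rfl
    · rw [Nat.mul_div_cancel_left _ (by norm_num)]
      exact two_pow_three_pow_ne_one k
    · rcases Nat.eq_zero_or_pos k with hk0 | hkpos
      · subst hk0
        simp only [pow_zero, mul_one] at hpd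
        exact absurd (Nat.le_of_dvd (by norm_num) hpd) (by norm_num)
      · obtain ⟨j, rfl⟩ : ∃ j, k = j + 1 := ⟨k - 1, by omega⟩
        have e : 2 * 3 ^ (j + 1) / 3 = 2 * 3 ^ j := by
          rw [pow_succ, ← mul_assoc, Nat.mul_div_cancel _ (by norm_num : 0 < 3)]
        rw [e]
        have := two_pow_two_mul_three_pow_ne_one (k := j + 1) (by omega)
        rwa [Nat.add_sub_cancel] at this

/-! ### Irreducibility and the field -/

/-- **`Φ_{3^{k+1}}` is irreducible over `𝔽₂`** (Lidl–Niederreiter Thm. 2.47(ii), Ex. 2.48). [folklore] -/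
private theorem cubePoly_irreducible (k : ℕ) : Irreducible (cubePoly k) := by
  have h2 : ¬ 2 ∣ 3 ^ (k + 1) := by
    intro h; exact absurd (Nat.Prime.dvd_of_dvd_pow Nat.prime_two h) (by norm_num)
  refine ZMod.irreducible_of_dvd_cyclotomic_of_natDegree (p := 2) h2 dvd_rfl ?_
  rw [natDegree_cubePoly]
  exact (orderOf_two_mod_three_pow k).symm

/-- `Φ_{3^{k+1}} = X^{2·3^k} + X^{3^k} + 1`. [folklore] -/
private theorem cubePoly_eq (k : ℕ) : cubePoly k = X ^ (2 * 3 ^ k) + X ^ 3 ^ k + 1 := by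
  rw [cubePoly, Polynomial.cyclotomic_prime_pow_eq_geom_sum Nat.prime_three]
  simp only [Finset.sum_range_succ, Finset.sum_range_zero, zero_add, ← pow_mul]
  ring

/-- `𝔽₂[X]/(Φ_{3^{k+1}})` is a field (local instance material: `Fact (Irreducible (cubePoly k))`). [folklore] -/
private theorem fact_irreducible_cubePoly (k : ℕ) : Fact (Irreducible (cubePoly k)) := ⟨cubePoly_irreducible k⟩

/-- **`|𝔽₂[X]/(Φ_{3^{k+1}})| = 2^{2·3^k}`** (for any finiteness structure; one is
`Fintype.ofEquiv _ (cubeEquiv k).symm.toEquiv`).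
[folklore] -/
private theorem card_cubeField (k : ℕ) [Fintype (AdjoinRoot (cubePoly k))] :
    Fintype.card (AdjoinRoot (cubePoly k)) = 2 ^ (2 * 3 ^ k) := by
  rw [Fintype.card_congr (cubeEquiv k).toEquiv]
  simp [ZMod.card]

end Cyclo

section Uniform

/-! ### Source `Summits/QuantumAdvantage/QuantumAdvantage/Theorems/SymplecticPurityNoFreeFrameUniform.lean` — polynomial-time uniformity of the witness family

Original module docstring:

# Route `SymplecticPurity`, item `NoFreeFrame` — the witness family is polynomial-time uniform

`cubeFamily.IsUniform` (and `IsOracleFree`): the description `sigmaEncode ⟨n, n, cubeCirc n⟩` is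
computed from `1ⁿ` in the typed `FP` algebra `CodeFP` (Arora–Barak 2009 §6.2, as set up in the tree by
`QuantumCircuitDescFP.lean`, `CodeFP*.lean` and the abstract-gate layer of `CoreDescAbstract.lean` /
`CoreDescBlockFP.lean`): the exponent lists `cubeExps` are fixed arithmetic expressions (`AExp`), the
program `cubeOpsA n` is two nested `flatMap`s over `[0, …, n-1]`, its compiled Clifford+T word is the
abstract program `progA`, and the Hadamard layer is `hLayerA (range n)`.
-/

open Literature.Computability.QuantumComplexity Literature.Computability.Cryptography
open Literature.Computability.Complexity Literature.Computability.Complexity.CodeFP AJLCore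
open _root_.Computability

/-! ### The exponent lists in `FP` -/

/-- The environment `([h, m], [])` of the exponent expressions. [folklore] -/
private theorem cubeEnv_fp : CodeFP (pairE natE natE) aenvE (fun p => ([p.1, p.2], ([] : List (List ℕ)))) :=
  codeFP_mkEnv (natList2 (fst _ _) (snd _ _)) (const _ [])

/-- **`(h, m) ↦ cubeExps h m` in `FP`.** [folklore] -/
private theorem cubeExps_fp : CodeFP (pairE natE natE) (rawE natE) (fun p => cubeExps p.1 p.2) := by
  have hE := cubeEnv_fp
  have h0 : CodeFP (pairE natE natE) bitE (fun p => (AExp.beq (.var 0) (.lit 0)).flag ([p.1, p.2], [])) :=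
    codeFP_flag' hE _
  have hlt : CodeFP (pairE natE natE) bitE
      (fun p => (AExp.lt (AExp.emod (.var 1) (.mul (.lit 3) (.var 0))) (.mul (.lit 2) (.var 0))).flag ([p.1, p.2], [])) := codeFP_flag' hE _
  have h1 : CodeFP (pairE natE natE) (rawE natE) (fun p => [(AExp.emod (.var 1) (.mul (.lit 3) (.var 0)))].map (AExp.eval ([p.1, p.2], []))) :=
    codeFP_evalList' hE _
  have h2 : CodeFP (pairE natE natE) (rawE natE)
      (fun p => [AExp.sub (AExp.emod (.var 1) (.mul (.lit 3) (.var 0))) (.var 0), AExp.sub (AExp.emod (.var 1) (.mul (.lit 3) (.var 0))) (.mul (.lit 2) (.var 0))].map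
        (AExp.eval ([p.1, p.2], []))) := codeFP_evalList' hE _
  refine ((h0.ite (const _ []) (hlt.ite h1 h2)).congr fun p => ?_)
  obtain ⟨h, m⟩ := p
  simp only [AExp.flag_beq, AExp.flag_lt, AExp.eval, List.map_cons, List.map_nil,
    List.getD_cons_zero, List.getD_cons_succ, decide_eq_true_eq, cubeExps]

/-! ### The program `cubeOpsA` in `FP` -/

/-- Binary value of the unary first component. [folklore] -/
private theorem unFst_toNat {β : Type} {eβ : β → List Bool} : CodeFP (pairE unE eβ) natE (fun p => p.1) :=
  (natOfUn.comp (fst _ _)).congr fun _ => rfl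

/-- The linear chunk of input wire `i`: `(1ⁿ, i) ↦ [CNOT i (n + l) | l ∈ cubeExps (n/2) (3i)]`. [folklore] -/
private theorem cubeLinChunk_fp : CodeFP (pairE unE natE) (rawE clopE)
    (fun p => (cubeExps (p.1 / 2) (3 * p.2)).map fun l => ClOp.cnot p.2 (p.1 + l)) := by
  have hinner : CodeFP (pairE (pairE unE natE) natE) clopE
      (fun t => ClOp.cnot t.1.2 (t.1.1 + t.2)) :=
    clop_cnot (fst _ _).snd' (natAdd.comp ((unFst_toNat.comp (fst _ _)).pair (snd _ _)))
  have hexps : CodeFP (pairE unE natE) (rawE natE) (fun p => cubeExps (p.1 / 2) (3 * p.2)) :=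
    cubeExps_fp.comp ((natDiv.comp (unFst_toNat.pair (const _ 2))).pair (natMul.comp ((const _ 3).pair (snd _ _))))
  exact ((map hinner).comp ((CodeFP.id _).pair hexps)).congr fun _ => rfl

/-- **`1ⁿ ↦ cubeLinOps n` in `FP`.** [folklore] -/
private theorem cubeLinOps_fp : CodeFP unE (rawE clopE) cubeLinOps := by
  have h := (map (σ := ℕ) (eσ := unE) cubeLinChunk_fp).comp ((CodeFP.id _).pair urange)
  exact ((flatten clopE).comp h).congr fun n => by
    rw [cubeLinOps, List.flatMap_def]; rfl

/-- The quadratic chunk of a pair of input wires: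
`((1ⁿ, i), j) ↦ if i = j then [] else [TOF i j (n + l) | l ∈ cubeExps (n/2) (i + 2j)]`.
[folklore] -/
private theorem cubeQuadChunk_fp : CodeFP (pairE (pairE unE natE) natE) (rawE clopE)
    (fun t => if t.1.2 = t.2 then [] else
      (cubeExps (t.1.1 / 2) (t.1.2 + 2 * t.2)).map fun l => ClOp.toffoli t.1.2 t.2 (t.1.1 + l)) := by
  have hinner : CodeFP (pairE (pairE (pairE unE natE) natE) natE) clopE
      (fun u => ClOp.toffoli u.1.1.2 u.1.2 (u.1.1.1 + u.2)) :=
    clop_toffoli (fst _ _).fst'.snd' (fst _ _).snd'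
      (natAdd.comp ((unFst_toNat.comp (fst _ _).fst').pair (snd _ _)))
  have hexps : CodeFP (pairE (pairE unE natE) natE) (rawE natE)
      (fun t => cubeExps (t.1.1 / 2) (t.1.2 + 2 * t.2)) :=
    cubeExps_fp.comp ((natDiv.comp ((unFst_toNat.comp (fst _ _)).pair (const _ 2))).pair
      (natAdd.comp ((fst _ _).snd'.pair (natMul.comp ((const _ 2).pair (snd _ _))))))
  have hlist : CodeFP (pairE (pairE unE natE) natE) (rawE clopE)
      (fun t => (cubeExps (t.1.1 / 2) (t.1.2 + 2 * t.2)).map fun l => ClOp.toffoli t.1.2 t.2 (t.1.1 + l)) :=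
    ((map hinner).comp ((CodeFP.id _).pair hexps)).congr fun _ => rfl
  have heq : CodeFP (pairE (pairE unE natE) natE) bitE (fun t => decide (t.1.2 = t.2)) :=
    natEq.comp ((fst _ _).snd'.pair (snd _ _))
  exact (heq.ite (const _ []) hlist).congr fun t => by
    by_cases h : t.1.2 = t.2 <;> simp [h]

/-- The quadratic chunks of input wire `i`: `(1ⁿ, i) ↦ flatMap over j < n`. [folklore] -/
private theorem cubeQuadRow_fp : CodeFP (pairE unE natE) (rawE clopE)
    (fun p => (List.range p.1).flatMap fun j => if p.2 = j then [] else
      (cubeExps (p.1 / 2) (p.2 + 2 * j)).map fun l => ClOp.toffoli p.2 j (p.1 + l)) := by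
  have hrange : CodeFP (pairE unE natE) (rawE natE) (fun p => List.range p.1) := urange.comp (fst _ _)
  have h := (map cubeQuadChunk_fp).comp ((CodeFP.id _).pair hrange)
  exact ((flatten clopE).comp h).congr fun p => by rw [List.flatMap_def]; rfl

/-- **`1ⁿ ↦ cubeQuadOps n` in `FP`.** [folklore] -/
private theorem cubeQuadOps_fp : CodeFP unE (rawE clopE) cubeQuadOps := by
  have h := (map (σ := ℕ) (eσ := unE) cubeQuadRow_fp).comp ((CodeFP.id _).pair urange)
  exact ((flatten clopE).comp h).congr fun n => by
    rw [cubeQuadOps, List.flatMap_def]; rfl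

/-- **`1ⁿ ↦ cubeOpsA n` in `FP`.** [folklore] -/
private theorem cubeOpsA_fp : CodeFP unE (rawE clopE) cubeOpsA :=
  (clopAppend cubeLinOps_fp cubeQuadOps_fp).congr fun _ => rfl

/-- `1ⁿ ↦` the program with wires reduced mod `n + n` (the values of the `Fin`-transport). [folklore] -/
private theorem cubeOpsMod_fp : CodeFP unE (rawE clopE) (fun n => (cubeOpsA n).map (ClOp.map fun v => v % (n + n))) := by
  have hmod : CodeFP (pairE unE natE) natE (fun p => p.2 % (p.1 + p.1)) :=
    natMod.comp ((snd _ _).pair (natAdd.comp (unFst_toNat.pair unFst_toNat)))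
  have hop : CodeFP (pairE unE clopE) clopE (fun p => p.2.map fun v => v % (p.1 + p.1)) := by
    have hT : CodeFP (pairE unE clopE) ctE (fun t => clopTuple t.2) :=
      (transparent (eα := clopE) (eβ := ctE) (g := clopTuple) fun _ => rfl).comp (snd _ _)
    have hm : CodeFP (pairE (pairE unE clopE) natE) natE (fun q => q.2 % (q.1.1 + q.1.1)) :=
      hmod.comp ((fst _ _).fst'.pair (snd _ _))
    have hws : CodeFP (pairE unE clopE) (rawE natE) (fun t => (clopTuple t.2).2.map fun v => v % (t.1 + t.1)) :=
      ((map (g := fun q : (ℕ × ClOp ℕ) × ℕ => q.2 % (q.1.1 + q.1.1)) hm).comp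
        ((CodeFP.id _).pair hT.snd')).congr fun _ => rfl
    exact clop_of_tuple (hT.fst'.pair hws) fun t => AJLCore.BP.clopTuple_map _ _
  exact ((map hop).comp ((CodeFP.id _).pair cubeOpsA_fp)).congr fun _ => rfl

/-! ### The description of the witness circuit -/

/-- The witness circuits are oracle-free. [folklore] -/
private theorem cubeCirc_isOracleFree (n : ℕ) : (cubeCirc n).IsOracleFree := by
  intro g hg
  simp only [cubeCirc, cubeGates] at hg
  split_ifs at hg with hn
  · rw [List.mem_append, List.mem_map] at hg
    rcases hg with ⟨i, -, rfl⟩ | hg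
    · trivial
    · exact revCompile_isOracleFree _ g hg
  · simp at hg

/-- **The witness family is oracle-free.** [folklore] -/
private theorem cubeFamily_isOracleFree : cubeFamily.IsOracleFree := fun n => cubeCirc_isOracleFree n

/-- The abstract gate list of the witness circuit: the Hadamard layer on `0 … n-1` followed by the
abstractly compiled cube program with wires reduced mod `n + n`.
[folklore] -/
private theorem map_toAG_cubeGates (n : ℕ) :
    (cubeGates n).map toAG =
      hLayerA (List.range n) ++ progA ((cubeOpsA n).map (ClOp.map fun v => v % (n + n))) := by
  unfold cubeGates
  split_ifs with hn
  · have e1 : (List.finRange n).map (fun i => hOn (Fin.castAdd n i)) =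
        ((List.finRange n).map (Fin.castAdd n)).map hOn := by rw [List.map_map]; rfl
    rw [List.map_append, e1, map_toAG_map_hOn, List.map_map, map_toAG_revCompile_toRevList,
      cubeOpsFin, map_val_map_finOf]
    congr 2
    rw [← List.map_coe_finRange_eq_range (n := n)]
    rfl
  · have h0 : n = 0 := by omega
    subst h0
    rfl

/-- The description of the witness circuit through its abstract gate list. [folklore] -/
private theorem sigmaEncode_cubeCirc (n : ℕ) :
    QCircuit.sigmaEncode (G := cliffordT) ⟨n, n, cubeCirc n⟩ =
      boolPair (encodeNat n) (boolPair (unaryEncodeNat n)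
        (rawE agE (hLayerA (List.range n) ++ progA ((cubeOpsA n).map (ClOp.map fun v => v % (n + n)))))) := by
  rw [QCircuit.sigmaEncode_eq, encode_eq_rawE (cubeCirc n) (cubeCirc_isOracleFree n)]
  simp only [cubeCirc, map_toAG_cubeGates]

/-- The abstract gate list in `FP`. [folklore] -/
private theorem cubeGatesA_fp : CodeFP unE (rawE agE0)
    (fun n => hLayerA (List.range n) ++ progA ((cubeOpsA n).map (ClOp.map fun v => v % (n + n)))) :=
  agAppend (hLayerA_fp.comp urange) (progA_fp.comp cubeOpsMod_fp)

/-- **The description of the witness family in polynomial time.** [folklore] -/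
private theorem desc_codeFP : CodeFP unE (QCircuit.sigmaEncode (G := cliffordT))
    (fun n => (⟨n, cubeFamily.ancillas n, cubeFamily.circ n⟩ : Σ n m : ℕ, QCircuit cliffordT (n + m))) := by
  have hc : CodeFP unE (rawE agE)
      (fun n => hLayerA (List.range n) ++ progA ((cubeOpsA n).map (ClOp.map fun v => v % (n + n)))) :=
    ((map₀ agE_of_agE0).comp cubeGatesA_fp).congr fun _ => List.map_id _
  have h : CodeFP unE (pairE natE (pairE unE (rawE agE)))
      (fun n => (n, n, hLayerA (List.range n) ++ progA ((cubeOpsA n).map (ClOp.map fun v => v % (n + n))))) :=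
    natOfUn.pair ((CodeFP.id _).pair hc)
  exact h.recodeOut fun n => by
    show _ = QCircuit.sigmaEncode (G := cliffordT) ⟨n, n, cubeCirc n⟩
    rw [sigmaEncode_cubeCirc]; rfl

/-- **The witness family is polynomial-time uniform.** [folklore] -/
private theorem cubeFamily_isUniform : cubeFamily.IsUniform := desc_codeFP.polyTimeComputable

end Uniform

section Purity

/-! ### Source `Summits/QuantumAdvantage/QuantumAdvantage/Theorems/SymplecticPurityNoFreeFramePurity.lean` — flat Pauli spectrum ⇒ a low-purity linear cut in every Clifford frame (ancilla-free form)

Original module docstring: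

# Route `SymplecticPurity`, item `NoFreeFrame` (stmt-QuantumAdvantage-10731) — purity as spectral mass

Helper file (no ancillas, `m = 0` case of the route's purity bound):

* `sum_stringsOn_kernel` : `Σ_{S ∈ 𝒫^W} S_{xy} conj(S_{x'y'}) = 2^{|W|} [x|_W = x'|_W][y|_W = y'|_W]
  [x|_{Wᶜ} = y|_{Wᶜ}][x'|_{Wᶜ} = y'|_{Wᶜ}]` (completeness of the Pauli strings, all labels);
* `two_pow_mul_puritySum` : the 4-fold agreement sum of the route (`Tr ρ_{<k}²`) is
  `2^{-k} Σ_{S ∈ 𝒫^{<k}} |⟨φ|S|φ⟩|²`;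
* `clifford_conj_surjective` : a unitary normalising the Pauli group (semantically) also
  conjugates every Pauli string BACK to a phase times a Pauli string, identity only for the identity;
* `norm_puritySum_mulVec_le` : for a unit `ε`-flat `ψ` and any such `U`, every linear cut of `U ψ`
  has purity `≤ 2^{-k} + 2^k ε²`.
-/

open _root_.Matrix _root_.Finset
open Literature.Computability.QuantumComplexity Literature.Computability.Cryptography

variable {N : ℕ}

/-! ### The completeness kernel on a wire set, all labels -/

/-- One-site kernel off the wire set: only the identity is summed. [folklore] -/
private theorem sum_singleton_I_mat (a b c d : Bool) :
    ∑ Q ∈ ({Pauli.I} : Finset Pauli), Pauli.mat Q a b * Pauli.mat Q d c =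
      if a = b ∧ d = c then 1 else 0 := by
  rw [Finset.sum_singleton]
  simp only [Pauli.mat, Matrix.one_apply]
  by_cases h1 : a = b <;> by_cases h2 : d = c <;> simp [h1, h2]

/-- **Completeness kernel on `W`, arbitrary labels**:
`Σ_{S ∈ 𝒫^W} S_{xy} conj(S_{x'y'}) = 2^{|W|}` if `x, x'` and `y, y'` agree on `W` while `x, y` and
`x', y'` agree off `W`, and `0` otherwise.
[folklore] -/
private theorem sum_stringsOn_kernel (W : Finset (Fin N)) (x y x' y' : Fin N → Bool) :
    ∑ S ∈ stringsOn W, pauliString S x y * star (pauliString S x' y') =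
      if (∀ i, i ∈ W → x i = x' i ∧ y i = y' i) ∧ (∀ i, i ∉ W → x i = y i ∧ x' i = y' i) then
        (2 : ℂ) ^ W.card else 0 := by
  classical
  have hstar : ∀ S : Fin N → Pauli, star (pauliString S x' y') = pauliString S y' x' := fun S => by
    have := congrFun (congrFun (conjTranspose_pauliString S) y') x'
    rwa [Matrix.conjTranspose_apply] at this
  simp only [hstar]
  simp only [pauliString_eq, tensorAll_apply, ← Finset.prod_mul_distrib, stringsOn]
  rw [← Finset.prod_univ_sum (fun i => if i ∈ W then Finset.univ else {Pauli.I})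
    (fun i Q => Pauli.mat Q (x i) (y i) * Pauli.mat Q (y' i) (x' i))]
  have key : ∀ i, (∑ Q ∈ (if i ∈ W then Finset.univ else {Pauli.I}),
      Pauli.mat Q (x i) (y i) * Pauli.mat Q (y' i) (x' i)) =
      if i ∈ W then (if x i = x' i ∧ y i = y' i then 2 else 0)
      else (if x i = y i ∧ x' i = y' i then 1 else 0) := by
    intro i
    by_cases hi : i ∈ W
    · simp only [hi, if_true, Pauli.sum_mat_mul_mat]
    · rw [if_neg hi, if_neg hi, sum_singleton_I_mat]
      by_cases h1 : x i = y i <;> by_cases h2 : x' i = y' i <;> simp [h1, h2, eq_comm]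
  simp only [key]
  by_cases hcond : (∀ i, i ∈ W → x i = x' i ∧ y i = y' i) ∧ (∀ i, i ∉ W → x i = y i ∧ x' i = y' i)
  · rw [if_pos hcond]
    have : ∀ i, (if i ∈ W then (if x i = x' i ∧ y i = y' i then (2 : ℂ) else 0)
        else (if x i = y i ∧ x' i = y' i then 1 else 0)) = if i ∈ W then 2 else 1 := by
      intro i
      by_cases hi : i ∈ W
      · rw [if_pos hi, if_pos hi, if_pos (hcond.1 i hi)]
      · rw [if_neg hi, if_neg hi, if_pos (hcond.2 i hi)]
    simp only [this]
    rw [Finset.prod_ite, Finset.prod_const_one, mul_one, Finset.prod_const]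
    congr 1
    simp
  · rw [if_neg hcond]
    have : ∃ i, (if i ∈ W then (if x i = x' i ∧ y i = y' i then (2 : ℂ) else 0)
        else (if x i = y i ∧ x' i = y' i then 1 else 0)) = 0 := by
      by_contra hc
      push Not at hc
      apply hcond
      constructor
      · intro i hi
        have := hc i
        rw [if_pos hi] at this
        by_contra h'
        exact this (if_neg h')
      · intro i hi
        have := hc i
        rw [if_neg hi] at this
        by_contra h'
        exact this (if_neg h')
    obtain ⟨i, hi⟩ := this
    exact Finset.prod_eq_zero (Finset.mem_univ i) hi

/-! ### Purity as spectral mass -/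

/-- The squared modulus of a Pauli expectation as a 4-fold sum over labels. [folklore] -/
private theorem norm_sq_pauliExp (S : Fin N → Pauli) (φ : QReg N → ℂ) :
    ((‖pauliExp S φ‖ ^ 2 : ℝ) : ℂ) =
      ∑ x, ∑ y, ∑ x', ∑ y', (starRingEnd ℂ) (φ x) * φ y * φ x' * (starRingEnd ℂ) (φ y') *
        (pauliString S x y * star (pauliString S x' y')) := by
  rw [show (((‖pauliExp S φ‖ ^ 2 : ℝ) : ℂ)) = pauliExp S φ * (starRingEnd ℂ) (pauliExp S φ) by
    rw [Complex.mul_conj']; push_cast; rfl]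
  have h1 : pauliExp S φ = ∑ x, ∑ y, (starRingEnd ℂ) (φ x) * pauliString S x y * φ y := by
    simp only [pauliExp, dotProduct, Matrix.mulVec, Pi.star_apply, Complex.star_def, Finset.mul_sum]
    refine Finset.sum_congr rfl fun x _ => Finset.sum_congr rfl fun y _ => by ring
  rw [h1]
  simp only [map_sum]
  rw [Finset.sum_mul]
  refine Finset.sum_congr rfl fun x _ => ?_
  rw [Finset.sum_mul]
  refine Finset.sum_congr rfl fun y _ => ?_
  rw [Finset.mul_sum]
  refine Finset.sum_congr rfl fun x' _ => ?_
  rw [Finset.mul_sum]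
  refine Finset.sum_congr rfl fun y' _ => ?_
  simp only [map_mul, Complex.conj_conj]
  rw [Complex.star_def]
  ring

/-- Membership in the cut set. [folklore] -/
@[simp] private theorem mem_cutSet {k : ℕ} {i : Fin N} : i ∈ cutSet N k ↔ i.val < k := by
  simp [cutSet]

/-- The cut set of a cut `k ≤ N` has `k` wires. [folklore] -/
private theorem card_cutSet {k : ℕ} (hk : k ≤ N) : (cutSet N k).card = k := by
  have : cutSet N k = (Finset.univ : Finset (Fin k)).map (Fin.castLEEmb hk) := by
    ext i
    simp only [mem_cutSet, Finset.mem_map, Finset.mem_univ, true_and]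
    constructor
    · intro hi; exact ⟨⟨i.val, hi⟩, Fin.ext rfl⟩
    · rintro ⟨j, rfl⟩; exact j.isLt
  rw [this, Finset.card_map, Finset.card_univ, Fintype.card_fin]

/-- **Purity is spectral mass** (the `m = 0` heart of the route's mechanism):
`2^k · Tr ρ_{<k}² = Σ_{S ∈ 𝒫^{<k}} |⟨φ|S|φ⟩|²` for every cut `k ≤ N`, with `Tr ρ_{<k}²` the 4-fold
agreement sum `puritySum k φ`.
[folklore] -/
private theorem two_pow_mul_puritySum {k : ℕ} (hk : k ≤ N) (φ : QReg N → ℂ) :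
    (2 : ℂ) ^ k * puritySum k φ = ∑ S ∈ stringsOn (cutSet N k), ((‖pauliExp S φ‖ ^ 2 : ℝ) : ℂ) := by
  classical
  simp only [norm_sq_pauliExp]
  rw [Finset.sum_comm]
  simp only [Finset.sum_comm (s := stringsOn (cutSet N k)), ← Finset.mul_sum, sum_stringsOn_kernel,
    card_cutSet hk, mem_cutSet]
  -- swap the first two labels on the right (`x ↔ y`) to align the conjugations with `puritySum`
  conv_rhs => rw [Finset.sum_comm]
  rw [puritySum, Finset.mul_sum]
  refine Finset.sum_congr rfl fun x₁ _ => ?_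
  rw [Finset.mul_sum]
  refine Finset.sum_congr rfl fun x₂ _ => ?_
  rw [Finset.mul_sum]
  refine Finset.sum_congr rfl fun x₃ _ => ?_
  rw [Finset.mul_sum]
  refine Finset.sum_congr rfl fun x₄ _ => ?_
  by_cases h : (∀ i, k ≤ i.val → x₁ i = x₂ i) ∧ (∀ i, i.val < k → x₂ i = x₃ i) ∧
      (∀ i, k ≤ i.val → x₃ i = x₄ i) ∧ (∀ i, i.val < k → x₄ i = x₁ i)
  · rw [if_pos h, if_pos]
    · simp only [Complex.star_def]; ring
    · refine ⟨fun i hi => ⟨h.2.1 i hi, (h.2.2.2 i hi).symm⟩, fun i hi => ?_⟩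
      have hi' : k ≤ i.val := Nat.le_of_not_lt hi
      exact ⟨(h.1 i hi').symm, h.2.2.1 i hi'⟩
  · rw [if_neg h, if_neg, mul_zero, mul_zero]
    intro h'
    apply h
    refine ⟨fun i hi => ((h'.2 i (Nat.not_lt.2 hi)).1).symm, fun i hi => (h'.1 i hi).1,
      fun i hi => (h'.2 i (Nat.not_lt.2 hi)).2, fun i hi => ((h'.1 i hi).2).symm⟩

/-! ### Clifford unitaries, read backwards -/

/-- A Pauli string that is a scalar multiple of another one is that one. [folklore] -/
private theorem pauliString_eq_of_smul_eq {c : ℂ} {S T : Fin N → Pauli}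
    (h : c • pauliString S = pauliString T) : S = T := by
  classical
  have ht := congrArg (fun M => (pauliString T * M).trace) h
  simp only [Matrix.mul_smul, Matrix.trace_smul, trace_pauliString_mul_pauliString,
    smul_eq_mul] at ht
  by_contra hne
  rw [if_neg (Ne.symm hne), if_pos trivial, mul_zero] at ht
  exact absurd ht.symm (pow_ne_zero _ two_ne_zero)

/-- **Clifford unitaries conjugate Pauli strings back to Pauli strings.** If `U` is unitary and
`U σ_S U† = c_S σ_{S'}` (`|c_S| = 1`) for every Pauli string `S`, then `S ↦ S'` is a bijection, so for
every `S` there are `T` and a unit `c` with `U† σ_S U = c σ_T`, and `T = I` only if `S = I`.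
[folklore] -/
private theorem clifford_conj_back {U : Matrix (QReg N) (QReg N) ℂ} (hU : U ∈ Matrix.unitaryGroup (QReg N) ℂ)
    (hcl : ∀ S : Fin N → Pauli, ∃ S' : Fin N → Pauli, ∃ c : ℂ, ‖c‖ = 1 ∧
      U * pauliString S * star U = c • pauliString S')
    (S : Fin N → Pauli) :
    ∃ T : Fin N → Pauli, ∃ c : ℂ, ‖c‖ = 1 ∧ star U * pauliString S * U = c • pauliString T ∧
      (T = (fun _ => Pauli.I) → S = fun _ => Pauli.I) := by
  classical
  have hU1 : star U * U = 1 := Matrix.mem_unitaryGroup_iff'.1 hU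
  have hU2 : U * star U = 1 := Matrix.mem_unitaryGroup_iff.1 hU
  choose Φ c hc hΦ using hcl
  -- `Φ` is injective
  have hinj : Function.Injective Φ := by
    intro S₁ S₂ h12
    have e0 : ∀ S₀, pauliString S₀ = c S₀ • (star U * pauliString (Φ S₀) * U) := by
      intro S₀
      rw [← Matrix.smul_mul, ← Matrix.mul_smul, ← hΦ S₀]
      simp only [Matrix.mul_assoc, hU1, Matrix.mul_one]
      rw [← Matrix.mul_assoc, hU1, Matrix.one_mul]
    have e1 := e0 S₁
    have e2 := e0 S₂
    have hc2 : c S₂ ≠ 0 := fun h0 => by have := hc S₂; rw [h0, norm_zero] at this; exact zero_ne_one this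
    have : (c S₁ * (c S₂)⁻¹) • pauliString S₂ = pauliString S₁ := by
      rw [e1, e2, h12, smul_smul, mul_assoc, inv_mul_cancel₀ hc2, mul_one]
    exact (pauliString_eq_of_smul_eq this).symm
  have hsurj : Function.Surjective Φ := Finite.injective_iff_surjective.1 hinj
  obtain ⟨T, hT⟩ := hsurj S
  have hcT : c T ≠ 0 := fun h0 => by have := hc T; rw [h0, norm_zero] at this; exact zero_ne_one this
  refine ⟨T, (c T)⁻¹, by rw [norm_inv, hc T, inv_one], ?_, ?_⟩
  · -- `U† σ_S U = c_T⁻¹ σ_T`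
    have h := hΦ T
    rw [hT] at h
    have h' : star U * (U * pauliString T * star U) * U = star U * (c T • pauliString S) * U := by rw [h]
    rw [Matrix.mul_smul, Matrix.smul_mul] at h'
    have lhs : star U * (U * pauliString T * star U) * U = pauliString T := by
      simp only [Matrix.mul_assoc, hU1, Matrix.mul_one]
      rw [← Matrix.mul_assoc, hU1, Matrix.one_mul]
    rw [lhs] at h'
    rw [h', smul_smul, inv_mul_cancel₀ hcT, one_smul]
  · intro hTI
    have h := hΦ T
    have hT1 : pauliString T = 1 := by rw [hTI, pauliString_const_I]
    rw [hT, hT1, Matrix.mul_one, hU2] at h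
    exact pauliString_eq_of_smul_eq (c := c T) (by rw [pauliString_const_I]; exact h.symm)

/-- The expectation of `σ_S` in `U ψ` is the expectation of `U† σ_S U` in `ψ`. [folklore] -/
private theorem pauliExp_mulVec (U : Matrix (QReg N) (QReg N) ℂ) (S : Fin N → Pauli) (ψ : QReg N → ℂ) :
    pauliExp S (U.mulVec ψ) = star ψ ⬝ᵥ (star U * pauliString S * U).mulVec ψ := by
  rw [pauliExp, Matrix.star_mulVec, ← Matrix.dotProduct_mulVec, Matrix.mulVec_mulVec,
    Matrix.mulVec_mulVec, Matrix.star_eq_conjTranspose]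

/-- The expectation of the identity string is the squared norm. [folklore] -/
private theorem pauliExp_const_I (ψ : QReg N → ℂ) :
    pauliExp (fun _ => Pauli.I) ψ = ((normSq ψ : ℝ) : ℂ) := by
  rw [pauliExp, pauliString_const_I, Matrix.one_mulVec, normSq]
  push_cast
  simp only [dotProduct, Pi.star_apply, Complex.star_def]
  exact Finset.sum_congr rfl fun x _ => Complex.conj_mul' _

/-! ### The purity bound in every Clifford frame (no ancillas) -/

/-- The number of Pauli strings on a `k`-set is `4^k`. [folklore] -/
private theorem card_stringsOn (W : Finset (Fin N)) : (stringsOn W).card = 4 ^ W.card := by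
  classical
  rw [stringsOn, Fintype.card_piFinset]
  rw [← Finset.prod_const, ← Finset.prod_filter_mul_prod_filter_not Finset.univ (· ∈ W)]
  have h1 : ∏ i ∈ Finset.univ.filter (· ∈ W), (if i ∈ W then (Finset.univ : Finset Pauli) else {Pauli.I}).card
      = ∏ i ∈ Finset.univ.filter (· ∈ W), 4 :=
    Finset.prod_congr rfl fun i hi => by
      rw [Finset.mem_filter] at hi; rw [if_pos hi.2, Finset.card_univ, Pauli.card_univ]
  have h2 : ∏ i ∈ Finset.univ.filter (fun i => ¬ i ∈ W),
      (if i ∈ W then (Finset.univ : Finset Pauli) else {Pauli.I}).card = 1 :=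
    Finset.prod_eq_one fun i hi => by
      rw [Finset.mem_filter] at hi; rw [if_neg hi.2, Finset.card_singleton]
  rw [h1, h2, mul_one]
  congr 1
  ext i; simp

/-- **Purity bound in every Clifford frame, no ancillas.** If `ψ` is a unit vector on `N` qubits with
`|⟨ψ|σ_S|ψ⟩| ≤ ε` for all `S ≠ I`, `U` is unitary and normalises the Pauli group up to phases, then for
every cut `k ≤ N` the purity of `U ψ` across `{wires < k}` is at most `2^{-k} + 2^k ε²`.
[folklore] -/
private theorem norm_puritySum_mulVec_le {ε : ℝ} {ψ : QReg N → ℂ} (hψ : normSq ψ = 1)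
    (hflat : ∀ S : Fin N → Pauli, S ≠ (fun _ => Pauli.I) → ‖pauliExp S ψ‖ ≤ ε)
    {U : Matrix (QReg N) (QReg N) ℂ} (hU : U ∈ Matrix.unitaryGroup (QReg N) ℂ)
    (hcl : ∀ S : Fin N → Pauli, ∃ S' : Fin N → Pauli, ∃ c : ℂ, ‖c‖ = 1 ∧
      U * pauliString S * star U = c • pauliString S')
    {k : ℕ} (hk : k ≤ N) :
    ‖puritySum k (U.mulVec ψ)‖ ≤ (2 : ℝ)⁻¹ ^ k + 2 ^ k * ε ^ 2 := by
  classical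
  have hε : 0 ≤ ε ^ 2 := sq_nonneg ε
  -- each non-identity term is at most `ε²`, the identity term is `1`
  have hterm : ∀ S ∈ stringsOn (cutSet N k), ‖pauliExp S (U.mulVec ψ)‖ ^ 2 ≤
      if S = (fun _ => Pauli.I) then 1 else ε ^ 2 := by
    intro S _
    obtain ⟨T, c, hc, hconj, hTI⟩ := clifford_conj_back hU hcl S
    have hexp : pauliExp S (U.mulVec ψ) = c * pauliExp T ψ := by
      rw [pauliExp_mulVec, hconj, Matrix.smul_mulVec, dotProduct_smul, smul_eq_mul, pauliExp]
    by_cases hS : S = fun _ => Pauli.I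
    · rw [if_pos hS]
      subst hS
      rw [pauliExp_mulVec]
      have : star U * pauliString (fun _ : Fin N => Pauli.I) * U = 1 := by
        rw [pauliString_const_I, Matrix.mul_one, Matrix.mem_unitaryGroup_iff'.1 hU]
      rw [this, Matrix.one_mulVec]
      have h1 : star ψ ⬝ᵥ ψ = ((normSq ψ : ℝ) : ℂ) := by
        rw [← pauliExp_const_I, pauliExp, pauliString_const_I, Matrix.one_mulVec]
      rw [h1, hψ]; simp
    · rw [if_neg hS, hexp, norm_mul, hc, one_mul]
      have hT : T ≠ fun _ => Pauli.I := fun h => hS (hTI h)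
      have := hflat T hT
      exact pow_le_pow_left₀ (norm_nonneg _) this 2
  have hsum : ∑ S ∈ stringsOn (cutSet N k), ‖pauliExp S (U.mulVec ψ)‖ ^ 2 ≤ 1 + 4 ^ k * ε ^ 2 := by
    refine (Finset.sum_le_sum hterm).trans ?_
    rw [Finset.sum_ite, Finset.sum_const, Finset.sum_const, nsmul_eq_mul, nsmul_eq_mul, mul_one]
    have hI : (stringsOn (cutSet N k)).filter (fun S => S = fun _ => Pauli.I) ⊆ {fun _ => Pauli.I} := by
      intro S hS; rw [Finset.mem_filter] at hS; rw [Finset.mem_singleton]; exact hS.2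
    have c1 : (((stringsOn (cutSet N k)).filter (fun S => S = fun _ => Pauli.I)).card : ℝ) ≤ 1 := by
      exact_mod_cast (Finset.card_le_card hI).trans (Finset.card_singleton _).le
    have c2 : (((stringsOn (cutSet N k)).filter (fun S => ¬ S = fun _ => Pauli.I)).card : ℝ) ≤ 4 ^ k := by
      have := (Finset.card_filter_le (stringsOn (cutSet N k)) (fun S => ¬ S = fun _ => Pauli.I))
      rw [card_stringsOn, card_cutSet hk] at this
      exact_mod_cast this
    nlinarith
  -- put together through `two_pow_mul_puritySum`
  have hid := two_pow_mul_puritySum hk (U.mulVec ψ)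
  have hnorm : (2 : ℝ) ^ k * ‖puritySum k (U.mulVec ψ)‖ =
      ∑ S ∈ stringsOn (cutSet N k), ‖pauliExp S (U.mulVec ψ)‖ ^ 2 := by
    have := congrArg norm hid
    rw [norm_mul, Complex.norm_pow, Complex.norm_ofNat] at this
    rw [this, ← Complex.ofReal_sum, Complex.norm_real, Real.norm_of_nonneg]
    exact Finset.sum_nonneg fun _ _ => sq_nonneg _
  have h2k : (0 : ℝ) < 2 ^ k := pow_pos two_pos k
  have hmain : (2 : ℝ) ^ k * ‖puritySum k (U.mulVec ψ)‖ ≤ 1 + 4 ^ k * ε ^ 2 := by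
    rw [hnorm]; exact hsum
  have h4 : (4 : ℝ) ^ k = 2 ^ k * 2 ^ k := by rw [← mul_pow]; norm_num
  rw [h4, mul_assoc] at hmain
  have hdiv : ‖puritySum k (U.mulVec ψ)‖ ≤ (1 + 2 ^ k * (2 ^ k * ε ^ 2)) / 2 ^ k := by
    rw [le_div_iff₀ h2k]; linarith
  calc ‖puritySum k (U.mulVec ψ)‖ ≤ (1 + 2 ^ k * (2 ^ k * ε ^ 2)) / 2 ^ k := hdiv
    _ = (2 : ℝ)⁻¹ ^ k + 2 ^ k * ε ^ 2 := by
        rw [inv_pow, add_div, mul_div_cancel_left₀ _ h2k.ne', one_div]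

end Purity

section Coord

/-! ### Source `Summits/QuantumAdvantage/QuantumAdvantage/Theorems/SymplecticPurityNoFreeFrameCoord.lean` — the cube map in coordinates: `cubeMap` is `y ↦ y³` in `𝔽₂[X]/(Φ_{3^{k+1}})` transported by `cubeEquiv`

Original module docstring:

# Route `SymplecticPurity`, item `NoFreeFrame` — the cube program computes `y ↦ y³`

For the good input lengths `n = 2·3^k` the Boolean map `cubeMap n` of the witness program is the
cube map of the field `K = 𝔽₂[X]/(Φ_{3^{k+1}})` read in the power-basis coordinates
`e = cubeEquiv k`:

  `cubeMap n y = (l ↦ [e((e⁻¹ y)³)_l = 1])`   (`cubeMap_eq_cube`).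

Steps: in `K`, `α^{3h} = 1` and `α^{2h} = α^h + 1` (`h = 3^k`, `α` the class of `X`), whence
`α^m = Σ_{l ∈ cubeExps h m} α^l` (`root_pow_eq_sum`) and the coordinates of `α^m` are the parities of
`cubeExps h m` (`cubeEquiv_root_pow`); `(Σ cᵢ αⁱ)³ = Σ_{i,j} cᵢ cⱼ α^{i+2j}` by Frobenius; and the program
side is an XOR network whose targets are ancillas and whose controls are inputs (`clEval_xor`), so
bit `l` is the parity `Σ_i cᵢ [l ∈ E(3i)] + Σ_{i≠j} cᵢ cⱼ [l ∈ E(i+2j)]` — the same double sum with its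
diagonal separated.
-/

open _root_.Polynomial
open Literature.Computability.QuantumComplexity Literature.Computability.Cryptography

section Field

variable (k : ℕ)

/-! ### Arithmetic in `𝔽₂[X]/(Φ_{3^{k+1}})` -/

/-- `K` is nontrivial. [folklore] -/
private theorem nontrivial_cubeField : Nontrivial (AdjoinRoot (cubePoly k)) :=
  AdjoinRoot.nontrivial _ (by
    rw [Polynomial.degree_cyclotomic]
    exact_mod_cast (Nat.totient_pos.2 (pow_pos (by norm_num) _)).ne')

/-- `2 = 0` in `K`. [folklore] -/
private theorem two_eq_zero : (2 : (AdjoinRoot (cubePoly k))) = 0 := by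
  rw [show (2 : (AdjoinRoot (cubePoly k))) = algebraMap (ZMod 2) (AdjoinRoot (cubePoly k)) 2 from (map_ofNat _ 2).symm,
    show (2 : ZMod 2) = 0 from rfl, map_zero]

/-- `x + x = 0` in `K`. [folklore] -/
private theorem add_self_eq_zero (x : (AdjoinRoot (cubePoly k))) : x + x = 0 := by rw [← two_mul, two_eq_zero, zero_mul]

/-- `K` has exponential characteristic `2` (Frobenius is additive). [folklore] -/
private theorem expChar_cubeField : ExpChar (AdjoinRoot (cubePoly k)) 2 := by
  haveI := nontrivial_cubeField k
  haveI : ExpChar (ZMod 2) 2 := ExpChar.prime Nat.prime_two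
  exact expChar_of_injective_algebraMap (algebraMap (ZMod 2) (AdjoinRoot (cubePoly k))).injective 2

/-- The defining relation: `(AdjoinRoot.root (cubePoly k))^{2·3^k} = (AdjoinRoot.root (cubePoly k))^{3^k} + 1`. [folklore] -/
private theorem root_pow_two_mul : ((AdjoinRoot.root (cubePoly k))) ^ (2 * 3 ^ k) = ((AdjoinRoot.root (cubePoly k))) ^ 3 ^ k + 1 := by
  have h : aeval ((AdjoinRoot.root (cubePoly k))) (X ^ (2 * 3 ^ k) + X ^ 3 ^ k + 1 : (ZMod 2)[X]) = 0 := by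
    rw [← cubePoly_eq, AdjoinRoot.aeval_eq, AdjoinRoot.mk_self]
  simp only [map_add, map_pow, aeval_X, map_one] at h
  rw [add_assoc] at h
  have h2 := eq_neg_of_add_eq_zero_left h
  rw [h2, neg_eq_iff_add_eq_zero, add_self_eq_zero]

/-- `(AdjoinRoot.root (cubePoly k))^{3^{k+1}} = 1` (`Φ_{3^{k+1}} ∣ X^{3^{k+1}} − 1`). [folklore] -/
private theorem root_pow_three_mul : ((AdjoinRoot.root (cubePoly k))) ^ (3 * 3 ^ k) = 1 := by
  have hd : cubePoly k ∣ X ^ (3 ^ (k + 1)) - 1 := Polynomial.cyclotomic.dvd_X_pow_sub_one _ _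
  have h : aeval ((AdjoinRoot.root (cubePoly k))) (X ^ (3 ^ (k + 1)) - 1 : (ZMod 2)[X]) = 0 := by
    rw [AdjoinRoot.aeval_eq, AdjoinRoot.mk_eq_zero.2 hd]
  simp only [map_sub, map_pow, aeval_X, map_one, sub_eq_zero] at h
  rw [← h, pow_succ]
  ring_nf

/-- Exponents of `(AdjoinRoot.root (cubePoly k))` only matter modulo `3·3^k`. [folklore] -/
private theorem root_pow_mod (m : ℕ) : ((AdjoinRoot.root (cubePoly k))) ^ m = ((AdjoinRoot.root (cubePoly k))) ^ (m % (3 * 3 ^ k)) := by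
  conv_lhs => rw [← Nat.mod_add_div m (3 * 3 ^ k), pow_add, pow_mul, root_pow_three_mul, one_pow,
    mul_one]

/-- **`(AdjoinRoot.root (cubePoly k))^m` is the sum of the powers listed by `cubeExps 3^k m`.** [folklore] -/
private theorem root_pow_eq_sum (m : ℕ) : ((AdjoinRoot.root (cubePoly k))) ^ m = ((cubeExps (3 ^ k) m).map fun l => ((AdjoinRoot.root (cubePoly k))) ^ l).sum := by
  have hh : (3 ^ k : ℕ) ≠ 0 := pow_ne_zero _ (by norm_num)
  rw [root_pow_mod, cubeExps, if_neg hh]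
  set r := m % (3 * 3 ^ k) with hr
  by_cases hlt : r < 2 * 3 ^ k
  · rw [if_pos hlt]; simp
  · rw [if_neg hlt]
    simp only [List.map_cons, List.map_nil, List.sum_cons, List.sum_nil, add_zero]
    have hr2 : 2 * 3 ^ k ≤ r := Nat.le_of_not_lt hlt
    conv_lhs => rw [show r = (r - 2 * 3 ^ k) + 2 * 3 ^ k by omega, pow_add, root_pow_two_mul, mul_add,
      mul_one, ← pow_add, show r - 2 * 3 ^ k + 3 ^ k = r - 3 ^ k by omega]

/-! ### Coordinates -/

/-- The power basis consists of the powers of `(AdjoinRoot.root (cubePoly k))`. [folklore] -/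
private theorem cubeBasis_apply (i : Fin (2 * 3 ^ k)) : cubeBasis k i = ((AdjoinRoot.root (cubePoly k))) ^ (i : ℕ) := by
  simp [cubeBasis, Module.Basis.reindex_apply, PowerBasis.coe_basis, AdjoinRoot.powerBasis'_gen]

/-- `cubeEquiv` is the coordinate map of `cubeBasis` (as a linear equivalence). [folklore] -/
private theorem cubeEquiv_apply (z : (AdjoinRoot (cubePoly k))) : cubeEquiv k z = (cubeBasis k).equivFun z := rfl

/-- The coordinates of a power of `(AdjoinRoot.root (cubePoly k))` below the degree. [folklore] -/
private theorem cubeEquiv_root_pow_of_lt {l' : ℕ} (hl' : l' < 2 * 3 ^ k) (l : Fin (2 * 3 ^ k)) :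
    cubeEquiv k (((AdjoinRoot.root (cubePoly k))) ^ l') l = if l' = (l : ℕ) then 1 else 0 := by
  rw [show ((AdjoinRoot.root (cubePoly k))) ^ l' = cubeBasis k ⟨l', hl'⟩ from (cubeBasis_apply k ⟨l', hl'⟩).symm, cubeEquiv_apply,
    Module.Basis.equivFun_self]
  simp only [Fin.ext_iff]

/-- Evaluating a list sum of coordinate vectors. [folklore] -/
private theorem list_sum_apply {n : ℕ} (L : List (Fin n → ZMod 2)) (l : Fin n) :
    L.sum l = (L.map fun f => f l).sum := by
  induction L with
  | nil => rfl
  | cons f L ih => rw [List.sum_cons, List.map_cons, List.sum_cons, Pi.add_apply, ih]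

/-- **The coordinates of `(AdjoinRoot.root (cubePoly k))^m` are the parities of `cubeExps 3^k m`.** [folklore] -/
private theorem cubeEquiv_root_pow (m : ℕ) (l : Fin (2 * 3 ^ k)) :
    cubeEquiv k (((AdjoinRoot.root (cubePoly k))) ^ m) l =
      ((cubeExps (3 ^ k) m).map fun l' => if l' = (l : ℕ) then (1 : ZMod 2) else 0).sum := by
  rw [root_pow_eq_sum, map_list_sum, list_sum_apply, List.map_map, List.map_map]
  congr 1
  refine List.map_congr_left fun l' hl' => ?_
  exact cubeEquiv_root_pow_of_lt k (lt_of_mem_cubeExps hl') l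

/-- The inverse coordinate map: `e⁻¹ c = Σ cᵢ αⁱ`. [folklore] -/
private theorem cubeEquiv_symm_apply (c : Fin (2 * 3 ^ k) → ZMod 2) :
    (cubeEquiv k).symm c = ∑ i, c i • ((AdjoinRoot.root (cubePoly k))) ^ (i : ℕ) := by
  rw [show (cubeEquiv k).symm c = (cubeBasis k).equivFun.symm c from rfl,
    Module.Basis.equivFun_symm_apply]
  simp only [cubeBasis_apply]

/-- **The cube of `Σ cᵢ αⁱ` is `Σ_{i,j} cᵢ cⱼ (AdjoinRoot.root (cubePoly k))^{i+2j}`** (Frobenius in characteristic `2`). [folklore] -/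
private theorem cube_expand (c : Fin (2 * 3 ^ k) → ZMod 2) :
    ((cubeEquiv k).symm c) ^ 3 = ∑ i, ∑ j, (c i * c j) • ((AdjoinRoot.root (cubePoly k))) ^ ((i : ℕ) + 2 * (j : ℕ)) := by
  haveI := expChar_cubeField k
  rw [cubeEquiv_symm_apply, pow_succ', sum_pow_char 2, Finset.sum_mul_sum]
  refine Finset.sum_congr rfl fun i _ => Finset.sum_congr rfl fun j _ => ?_
  rw [_root_.smul_pow, ZMod.pow_card, ← pow_mul, smul_mul_smul_comm, ← pow_add, mul_comm (j : ℕ) 2]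

/-- **Coordinates of the cube**: `e((e⁻¹c)³)_l = Σ_{i,j} cᵢ cⱼ · e((AdjoinRoot.root (cubePoly k))^{i+2j})_l`. [folklore] -/
private theorem cubeEquiv_cube (c : Fin (2 * 3 ^ k) → ZMod 2) (l : Fin (2 * 3 ^ k)) :
    cubeEquiv k (((cubeEquiv k).symm c) ^ 3) l =
      ∑ i : Fin (2 * 3 ^ k), ∑ j : Fin (2 * 3 ^ k),
        c i * c j * cubeEquiv k (((AdjoinRoot.root (cubePoly k))) ^ ((i : ℕ) + 2 * (j : ℕ))) l := by
  rw [cube_expand, cubeEquiv_apply, map_sum, Finset.sum_apply]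
  refine Finset.sum_congr rfl fun i _ => ?_
  rw [map_sum, Finset.sum_apply]
  refine Finset.sum_congr rfl fun j _ => ?_
  rw [map_smul, Pi.smul_apply, smul_eq_mul, cubeEquiv_apply]

end Field

/-! ### The program side: an XOR network -/

/-- **XOR networks.** If every control of `ops` is an input wire (`< n`) and every target an
ancilla wire (`≥ n`), then wire `i` ends as its initial value XOR the parity of the guards (read on
any assignment agreeing with the initial one on the inputs) of the gates targeting `i`.
[folklore] -/
private theorem clEval_xor (n : ℕ) : ∀ (ops : List (ClOp ℕ)), (∀ op ∈ ops, ∀ c ∈ op.controls, c < n) →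
    (∀ op ∈ ops, n ≤ op.target) → ∀ (w w' : ℕ → Bool), (∀ c, c < n → w c = w' c) → ∀ (i : ℕ),
    clEval ops w i =
      (w i ^^ ops.foldr (fun op acc => (decide (op.target = i) && op.guard w') ^^ acc) false)
  | [], _, _, w, w', _, i => by simp
  | op :: ops, hc, ht, w, w', hww, i => by
    have hc' : ∀ o ∈ ops, ∀ c ∈ o.controls, c < n := fun o ho => hc o (List.mem_cons_of_mem _ ho)
    have ht' : ∀ o ∈ ops, n ≤ o.target := fun o ho => ht o (List.mem_cons_of_mem _ ho)
    have hagree : ∀ c, c < n → op.eval w c = w' c := fun c hcn => by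
      rw [ClOp.eval_apply_of_ne _ _ (fun h => ?_), hww c hcn]
      have := ht op List.mem_cons_self; omega
    rw [clEval_cons, clEval_xor n ops hc' ht' (op.eval w) w' hagree i, List.foldr_cons, ClOp.eval_apply,
      ClOp.guard_congr op (fun c hcc => hww c (hc op List.mem_cons_self c hcc)), Bool.xor_assoc]

/-- Controls of the cube program are input wires. [folklore] -/
private theorem controls_lt_of_mem_cubeOpsA {n : ℕ} {op : ClOp ℕ} (hop : op ∈ cubeOpsA n) :
    ∀ c ∈ op.controls, c < n := by
  simp only [cubeOpsA, cubeLinOps, cubeQuadOps, List.mem_append, List.mem_flatMap, List.mem_map,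
    List.mem_range] at hop
  rcases hop with ⟨a, ha, l, -, rfl⟩ | ⟨a, ha, b, hb, hop⟩
  · simp [ClOp.controls, ha]
  · split_ifs at hop
    · simp at hop
    · rw [List.mem_map] at hop
      obtain ⟨l, -, rfl⟩ := hop
      simp [ClOp.controls, ha, hb]

/-- Booleans as elements of `𝔽₂`: XOR-parity is the sum. [folklore] -/
private theorem ite_foldr_xor (L : List Bool) :
    (if L.foldr xor false then (1 : ZMod 2) else 0) = (L.map fun b => if b then (1 : ZMod 2) else 0).sum := by
  induction L with
  | nil => simp
  | cons b L ih =>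
    rw [List.foldr_cons, List.map_cons, List.sum_cons, ← ih]
    generalize List.foldr xor false L = F
    cases b <;> cases F <;> decide

/-- Booleans as elements of `𝔽₂`: `&&` is the product. [folklore] -/
private theorem ite_and (a b : Bool) :
    (if (a && b) then (1 : ZMod 2) else 0) = (if a then (1 : ZMod 2) else 0) * (if b then 1 else 0) := by
  cases a <;> cases b <;> simp

/-- List sums over `range n` are `Finset.range` sums. [folklore] -/
private theorem sum_map_range {M : Type*} [AddCommMonoid M] (f : ℕ → M) (n : ℕ) :
    ((List.range n).map f).sum = ∑ i ∈ Finset.range n, f i := by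
  induction n with
  | zero => simp
  | succ n ih => rw [List.sum_range_succ, Finset.sum_range_succ, ih]

/-- Sum of a `flatMap` is the sum of the sums. [folklore] -/
private theorem sum_flatMap {α M : Type*} [AddMonoid M] (l : List α) (f : α → List M) :
    (l.flatMap f).sum = (l.map fun a => (f a).sum).sum := by
  induction l with
  | nil => simp
  | cons a l ih => rw [List.flatMap_cons, List.sum_append, List.map_cons, List.sum_cons, ih]

/-! ### The main identification -/

section Main

variable (k : ℕ)

/-- The parity, over the cube program, of the guards of the gates hitting ancilla `n + l`, as an
element of `𝔽₂`: `Σ_i c_i C(3i) + Σ_i Σ_{j ≠ i} c_i c_j C(i + 2j)` with `c_i = [w i]` and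
`C(m) = e((AdjoinRoot.root (cubePoly k))^m)_l`.
[folklore] -/
private theorem cubeOpsA_parity (w : ℕ → Bool) (l : Fin ((2 * 3 ^ k))) :
    (((cubeOpsA ((2 * 3 ^ k))).map fun op =>
        if (decide (op.target = ((2 * 3 ^ k)) + (l : ℕ)) && op.guard w) then (1 : ZMod 2) else 0).sum) =
      (∑ i ∈ Finset.range ((2 * 3 ^ k)),
          (if w i then (1 : ZMod 2) else 0) * cubeEquiv k (((AdjoinRoot.root (cubePoly k))) ^ (3 * i)) l) +
      ∑ i ∈ Finset.range ((2 * 3 ^ k)), ∑ j ∈ Finset.range ((2 * 3 ^ k)),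
        if i = j then 0 else
          (if w i then (1 : ZMod 2) else 0) * (if w j then 1 else 0) * cubeEquiv k (((AdjoinRoot.root (cubePoly k))) ^ (i + 2 * j)) l := by
  have hdiv : ((2 * 3 ^ k)) / 2 = 3 ^ k := by omega
  -- one chunk of gates onto the ancilla register, all with the same guard value `g`
  have hchunk : ∀ (m : ℕ) (g : ZMod 2) (mk : ℕ → ClOp ℕ),
      (∀ l', (mk l').target = ((2 * 3 ^ k)) + l') → (∀ l', (if (mk l').guard w then (1 : ZMod 2) else 0) = g) →
      (((cubeExps (3 ^ k) m).map mk).map fun op =>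
          if (decide (op.target = ((2 * 3 ^ k)) + (l : ℕ)) && op.guard w) then (1 : ZMod 2) else 0).sum =
        g * cubeEquiv k (((AdjoinRoot.root (cubePoly k))) ^ m) l := by
    intro m g mk htgt hguard
    rw [cubeEquiv_root_pow, List.map_map, mul_comm g, ← List.sum_map_mul_right]
    congr 1
    refine List.map_congr_left fun l' _ => ?_
    rw [Function.comp_apply, ite_and, hguard, htgt]
    congr 1
    simp [eq_comm]
  rw [cubeOpsA, List.map_append, List.sum_append]
  congr 1
  · -- the linear part
    rw [cubeLinOps, List.map_flatMap, sum_flatMap, sum_map_range, hdiv]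
    refine Finset.sum_congr rfl fun i _ => ?_
    exact hchunk (3 * i) _ (fun l' => ClOp.cnot i (((2 * 3 ^ k)) + l')) (fun _ => rfl) (fun _ => rfl)
  · -- the quadratic part
    rw [cubeQuadOps, List.map_flatMap, sum_flatMap, sum_map_range, hdiv]
    refine Finset.sum_congr rfl fun i _ => ?_
    rw [List.map_flatMap, sum_flatMap, sum_map_range]
    refine Finset.sum_congr rfl fun j _ => ?_
    by_cases hij : i = j
    · simp [hij]
    · rw [if_neg hij, if_neg hij]
      exact hchunk (i + 2 * j) _ (fun l' => ClOp.toffoli i j (((2 * 3 ^ k)) + l')) (fun _ => rfl)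
        (fun _ => by rw [← ite_and]; rfl)

/-- Splitting the diagonal off a double sum over `range n × range n` in `𝔽₂`. [folklore] -/
private theorem sum_sum_split_diag (n : ℕ) (c : ℕ → ZMod 2) (hc : ∀ i, c i * c i = c i) (C : ℕ → ZMod 2) :
    (∑ i ∈ Finset.range n, ∑ j ∈ Finset.range n, c i * c j * C (i + 2 * j)) =
      (∑ i ∈ Finset.range n, c i * C (3 * i)) +
        ∑ i ∈ Finset.range n, ∑ j ∈ Finset.range n, if i = j then 0 else c i * c j * C (i + 2 * j) := by
  rw [← Finset.sum_add_distrib]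
  refine Finset.sum_congr rfl fun i hi => ?_
  have hsplit : ∀ j, c i * c j * C (i + 2 * j) = (if i = j then c i * c j * C (i + 2 * j) else 0) +
      (if i = j then 0 else c i * c j * C (i + 2 * j)) := fun j => by
    by_cases h : i = j <;> simp [h]
  rw [Finset.sum_congr rfl fun j _ => hsplit j, Finset.sum_add_distrib, Finset.sum_ite_eq, if_pos hi, hc,
    show i + 2 * i = 3 * i by ring]

/-- **The cube program computes the cube map of `𝔽₂[X]/(Φ_{3^{k+1}})` in power-basis
coordinates**, as an identity in `𝔽₂`.
[folklore] -/
private theorem ite_cubeMap_eq (y : Fin ((2 * 3 ^ k)) → Bool) (l : Fin ((2 * 3 ^ k))) :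
    (if cubeMap ((2 * 3 ^ k)) y l then (1 : ZMod 2) else 0) =
      cubeEquiv k (((cubeEquiv k).symm fun i => if y i then 1 else 0) ^ 3) l := by
  have hwi : ∀ i : Fin ((2 * 3 ^ k)), RevSim.liftW (padInput y ((2 * 3 ^ k))) i = y i := fun i => by
    rw [show (i : ℕ) = ((Fin.castAdd ((2 * 3 ^ k)) i : Fin (((2 * 3 ^ k)) + ((2 * 3 ^ k)))) : ℕ) from rfl, RevSim.liftW_val]
    exact Fin.append_left _ _ _
  have hwl : RevSim.liftW (padInput y ((2 * 3 ^ k))) (((2 * 3 ^ k)) + l) = false := by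
    rw [show ((2 * 3 ^ k)) + (l : ℕ) = ((Fin.natAdd ((2 * 3 ^ k)) l : Fin (((2 * 3 ^ k)) + ((2 * 3 ^ k)))) : ℕ) from rfl, RevSim.liftW_val]
    exact Fin.append_right _ _ _
  generalize hw : RevSim.liftW (padInput y ((2 * 3 ^ k))) = w at hwi hwl
  -- program side
  have hprog : cubeMap ((2 * 3 ^ k)) y l = (cubeOpsA ((2 * 3 ^ k))).foldr
      (fun op acc => (decide (op.target = ((2 * 3 ^ k)) + (l : ℕ)) && op.guard w) ^^ acc) false := by
    show clEval (cubeOpsA ((2 * 3 ^ k))) (RevSim.liftW (padInput y ((2 * 3 ^ k)))) (((2 * 3 ^ k)) + l) = _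
    rw [hw, clEval_xor ((2 * 3 ^ k)) (cubeOpsA ((2 * 3 ^ k))) (fun op hop => controls_lt_of_mem_cubeOpsA hop)
      (fun op hop => le_target_of_mem_cubeOpsA hop) w w (fun _ _ => rfl) (((2 * 3 ^ k)) + l), hwl, Bool.false_xor]
  rw [hprog, show (cubeOpsA ((2 * 3 ^ k))).foldr (fun op acc => (decide (op.target = ((2 * 3 ^ k)) + (l : ℕ)) && op.guard w) ^^ acc) false
      = ((cubeOpsA ((2 * 3 ^ k))).map fun op => decide (op.target = ((2 * 3 ^ k)) + (l : ℕ)) && op.guard w).foldr xor false from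
      List.foldr_map.symm, ite_foldr_xor, List.map_map]
  rw [show ((fun b : Bool => if b then (1 : ZMod 2) else 0) ∘ fun op : ClOp ℕ =>
      decide (op.target = ((2 * 3 ^ k)) + ↑l) && op.guard w) = fun op =>
      if (decide (op.target = ((2 * 3 ^ k)) + (l : ℕ)) && op.guard w) then (1 : ZMod 2) else 0 from rfl,
    cubeOpsA_parity k w l]
  -- field side
  rw [cubeEquiv_cube]
  have hrhs : (∑ i : Fin ((2 * 3 ^ k)), ∑ j : Fin ((2 * 3 ^ k)), (if y i then (1 : ZMod 2) else 0) * (if y j then 1 else 0) *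
      cubeEquiv k (((AdjoinRoot.root (cubePoly k))) ^ ((i : ℕ) + 2 * (j : ℕ))) l) =
      ∑ i ∈ Finset.range ((2 * 3 ^ k)), ∑ j ∈ Finset.range ((2 * 3 ^ k)),
        (if w i then (1 : ZMod 2) else 0) * (if w j then 1 else 0) * cubeEquiv k (((AdjoinRoot.root (cubePoly k))) ^ (i + 2 * j)) l := by
    rw [← Fin.sum_univ_eq_sum_range (fun i => ∑ j ∈ Finset.range ((2 * 3 ^ k)),
      (if w i then (1 : ZMod 2) else 0) * (if w j then 1 else 0) * cubeEquiv k (((AdjoinRoot.root (cubePoly k))) ^ (i + 2 * j)) l) ((2 * 3 ^ k))]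
    refine Finset.sum_congr rfl fun i _ => ?_
    rw [← Fin.sum_univ_eq_sum_range (fun j =>
      (if w i then (1 : ZMod 2) else 0) * (if w j then 1 else 0) * cubeEquiv k (((AdjoinRoot.root (cubePoly k))) ^ ((i : ℕ) + 2 * j)) l) ((2 * 3 ^ k))]
    refine Finset.sum_congr rfl fun j _ => ?_
    rw [hwi i, hwi j]
  rw [hrhs, sum_sum_split_diag ((2 * 3 ^ k)) (fun i => if w i then (1 : ZMod 2) else 0) (fun i => by
    cases w i <;> simp) (fun m => cubeEquiv k (((AdjoinRoot.root (cubePoly k))) ^ m) l)]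

/-- **`cubeMap (2·3^k)` is the cube map of `𝔽₂[X]/(Φ_{3^{k+1}})` in power-basis coordinates**,
in exactly the Boolean dress of the route's `CubeGraphFlat`.
[folklore] -/
private theorem cubeMap_eq_cube (y : Fin ((2 * 3 ^ k)) → Bool) :
    cubeMap ((2 * 3 ^ k)) y = fun l => decide (cubeEquiv k (((cubeEquiv k).symm fun i => if y i then 1 else 0) ^ 3) l = 1) := by
  funext l
  have h := ite_cubeMap_eq k y l
  cases hb : cubeMap ((2 * 3 ^ k)) y l
  · rw [hb, if_neg Bool.false_ne_true] at h
    rw [← h]; decide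
  · rw [hb, if_pos rfl] at h
    rw [← h]; decide

end Main

end Coord

section Main

/-! ### Source `Summits/QuantumAdvantage/QuantumAdvantage/Theorems/SymplecticPurityNoFreeFrame.lean` — the closing file

Original module docstring:

# Route `SymplecticPurity`, item `NoFreeFrame` (stmt-QuantumAdvantage-10731): `¬ H_FF`

**The complexity-level kill.** `H_FF` asserts: every uniform oracle-free Clifford+T family `F`
admits `c` such that every intermediate state `F.stateAfter x j`, in SOME Clifford frame `U`
(unitary, normalising the Pauli group up to phases), has purity `≥ 1/(|x|^c + c)` across EVERY linear
cut. `noFreeFrame_proof : NoFreeFrame` refutes it with the ancilla-free witness family `cubeFamily`: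

* it is oracle-free and polynomial-time uniform (`…Uniform`);
* on the input `0ⁿ`, `n = 2·3^k`, its final state is the normalised graph state `2^{-n/2} Σ_y |y⟩|y³⟩`
  of the cube map of `𝔽₂[X]/(Φ_{3^{k+1}}) ≅ 𝔽_{2ⁿ}` (`…Family`, `…Coord`, `…Cyclo`);
* that state is `ε`-flat with `ε = 2·2^{-n/2}` (the route's `CubeGraphFlat`, proved in the tree as
  `CubeGraphFlat_proof`, stmt-QuantumAdvantage-9836);
* a unit `ε`-flat state has, in every Clifford frame, purity `≤ 2^{-h} + 2^{h} ε² = 5·2^{-h}` across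
  the cut `h = n/2` (`norm_puritySum_mulVec_le`, the ancilla-free case of `SymplecticPurityBound`);
* and `5·2^{-3^k} < 1/((2·3^k)^c + c)` for `k` large.
-/

open _root_.Matrix _root_.Finset _root_.Filter _root_.Topology
open Literature.Computability.QuantumComplexity Literature.Computability.Cryptography

/-! ### Normalised graph states: norm and Pauli expectations -/

section Graph

variable {m : ℕ}

/-- Sums over a doubled register split along `Fin.append`. [folklore] -/
private theorem sum_QReg_add {M : Type*} [AddCommMonoid M] (G : QReg (m + m) → M) :
    ∑ w, G w = ∑ y : QReg m, ∑ v : QReg m, G (Fin.append y v) := by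
  rw [← Equiv.sum_comp (Fin.appendEquiv m m), Fintype.sum_prod_type]
  rfl

/-- Halves of an appended label. [folklore] -/
private theorem append_castAdd_natAdd_fun (y v : QReg m) :
    (fun i => Fin.append y v (Fin.castAdd m i)) = y ∧ (fun j => Fin.append y v (Fin.natAdd m j)) = v :=
  ⟨funext fun i => Fin.append_left y v i, funext fun j => Fin.append_right y v j⟩

variable (F : QReg m → QReg m)

/-- The number of points on the graph of `F` inside the doubled register is `2^m`. [folklore] -/
private theorem card_graph : (univ.filter fun z : QReg (m + m) =>
    (fun l => z (Fin.natAdd m l)) = F (fun i => z (Fin.castAdd m i))).card = 2 ^ m := by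
  classical
  have h := sum_QReg_add (fun z : QReg (m + m) =>
    if (fun l => z (Fin.natAdd m l)) = F (fun i => z (Fin.castAdd m i)) then (1 : ℕ) else 0)
  rw [Finset.sum_boole] at h
  simp only [Nat.cast_id] at h
  rw [h]
  have inner : ∀ y : QReg m, (∑ v : QReg m, if (fun l => Fin.append y v (Fin.natAdd m l)) =
      F (fun i => Fin.append y v (Fin.castAdd m i)) then (1 : ℕ) else 0) = 1 := fun y => by
    rw [Finset.sum_eq_single (F y)]
    · obtain ⟨h1, h2⟩ := append_castAdd_natAdd_fun y (F y)
      rw [if_pos (by rw [h1, h2])]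
    · intro v _ hv
      obtain ⟨h1, h2⟩ := append_castAdd_natAdd_fun y v
      rw [if_neg (by rw [h1, h2]; exact hv)]
    · exact fun h => absurd (Finset.mem_univ _) h
  simp only [inner, Finset.sum_const, smul_eq_mul, mul_one, Finset.card_univ, Fintype.card_fun,
    Fintype.card_bool, Fintype.card_fin]

/-- `‖(1/√2)^m‖² · 2^m = 1`. [folklore] -/
private theorem norm_invSqrt2_pow_sq : ‖invSqrt2 ^ m‖ ^ 2 * 2 ^ m = 1 := by
  have h : ‖invSqrt2‖ ^ 2 = 1 / 2 := by
    rw [show invSqrt2 = 1 / (Real.sqrt 2 : ℂ) from rfl, Complex.norm_div, norm_one, Complex.norm_real,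
      Real.norm_of_nonneg (Real.sqrt_nonneg _), div_pow, one_pow, Real.sq_sqrt (by norm_num)]
  rw [norm_pow, ← pow_mul, mul_comm m 2, pow_mul, h, ← mul_pow]
  norm_num

/-- **The normalised graph state is a unit vector.** [folklore] -/
private theorem normSq_graphState : normSq (fun z : QReg (m + m) =>
    if (fun l => z (Fin.natAdd m l)) = F (fun i => z (Fin.castAdd m i)) then invSqrt2 ^ m else 0) = 1 := by
  classical
  rw [normSq]
  simp only [apply_ite norm, norm_zero, ite_pow, zero_pow (two_ne_zero), Finset.sum_ite, Finset.sum_const_zero,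
    add_zero, Finset.sum_const, card_graph, nsmul_eq_mul, Nat.cast_pow, Nat.cast_ofNat]
  rw [mul_comm]; exact norm_invSqrt2_pow_sq

/-- Bilinearity: the Pauli expectation of a rescaled vector. [folklore] -/
private theorem pauliExp_const_mul {N : ℕ} (S : Fin N → Pauli) (c : ℂ) (g : QReg N → ℂ) :
    pauliExp S (fun z => c * g z) = (starRingEnd ℂ c * c) * (star g ⬝ᵥ (pauliString S).mulVec g) := by
  simp only [pauliExp, dotProduct, Matrix.mulVec, Pi.star_apply, star_mul', Complex.star_def, Finset.mul_sum]
  refine Finset.sum_congr rfl fun z _ => Finset.sum_congr rfl fun z' _ => ?_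
  ring

/-- **Pauli expectations of the normalised graph state** are `2^{-m}` times those of the graph
vector.
[folklore] -/
private theorem pauliExp_graphState (S : Fin (m + m) → Pauli) :
    pauliExp S (fun z : QReg (m + m) =>
      if (fun l => z (Fin.natAdd m l)) = F (fun i => z (Fin.castAdd m i)) then invSqrt2 ^ m else 0) =
    (starRingEnd ℂ (invSqrt2 ^ m) * invSqrt2 ^ m) *
      (star (fun z : QReg (m + m) =>
        if (fun l => z (Fin.natAdd m l)) = F (fun i => z (Fin.castAdd m i)) then (1 : ℂ) else 0) ⬝ᵥ
        (pauliString S).mulVec (fun z : QReg (m + m) =>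
          if (fun l => z (Fin.natAdd m l)) = F (fun i => z (Fin.castAdd m i)) then (1 : ℂ) else 0)) := by
  classical
  rw [← pauliExp_const_mul]
  congr 1
  funext z
  split_ifs <;> simp

end Graph

/-! ### Flatness of the witness state at the good input lengths -/

/-- **The final state of the witness family is `2·2^{-n/2}`-flat** at `n = 2·3^k`: for every
Pauli string `S ≠ I`, `|⟨ψ|σ_S|ψ⟩| ≤ (1/2)^n · 2√2ⁿ`, where `ψ` is the normalised graph state of
`cubeMap n` (stated for a variable `m = 2·3^k` to be instantiated at `m = |x|`).
[folklore] -/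
private theorem pauliExp_cubeState_le (k m : ℕ) (hm : m = 2 * 3 ^ k) (S : Fin (m + m) → Pauli)
    (hS : S ≠ fun _ => Pauli.I) :
    ‖pauliExp S (fun z : QReg (m + m) =>
      if (fun l => z (Fin.natAdd m l)) = cubeMap m (fun i => z (Fin.castAdd m i)) then invSqrt2 ^ m else 0)‖ ≤
      (1 / 2 : ℝ) ^ m * (2 * Real.sqrt 2 ^ m) := by
  subst hm
  rw [pauliExp_graphState, norm_mul, Complex.norm_mul, Complex.norm_conj, ← sq]
  have hc : ‖invSqrt2 ^ (2 * 3 ^ k)‖ ^ 2 = (1 / 2 : ℝ) ^ (2 * 3 ^ k) := by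
    have := norm_invSqrt2_pow_sq (m := 2 * 3 ^ k)
    rw [one_div, inv_pow]; exact eq_inv_of_mul_eq_one_left this
  rw [hc]
  refine mul_le_mul_of_nonneg_left ?_ (by positivity)
  -- the graph vector of `cubeMap (2·3^k)` is the cube graph vector of `CubeGraphFlat`
  haveI : Fact (Irreducible (cubePoly k)) := fact_irreducible_cubePoly k
  letI : Fintype (AdjoinRoot (cubePoly k)) := Fintype.ofEquiv _ (cubeEquiv k).symm.toEquiv
  have hK : Fintype.card (AdjoinRoot (cubePoly k)) = 2 ^ (2 * 3 ^ k) := card_cubeField k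
  have h := cubeGraphFlat_holds (2 * 3 ^ k) (AdjoinRoot (cubePoly k)) hK (cubeEquiv k) S hS
  simp only [cubeMap_eq_cube k]
  exact h

/-! ### The witness input -/

/-- The all-zero input of length `n`. [folklore] -/
private theorem replicate_get (n : ℕ) (i : Fin (List.replicate n false).length) :
    (List.replicate n false).get i = false :=
  List.eq_of_mem_replicate (List.get_mem _ _)

/-! ### The asymptotics: `5·2^{-h}` beats `1/((2h)^c + c)` -/

/-- For every `c`, eventually `(5·2^c·h^c + 5c)·(1/2)^h < 1`. [folklore] -/
private theorem eventually_small (c : ℕ) : ∃ H : ℕ, ∀ h : ℕ, H ≤ h →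
    (5 * 2 ^ c * (h : ℝ) ^ c + 5 * c) * (1 / 2 : ℝ) ^ h < 1 := by
  have h1 : Tendsto (fun h : ℕ => (h : ℝ) ^ c * (1 / 2 : ℝ) ^ h) atTop (𝓝 0) :=
    tendsto_pow_const_mul_const_pow_of_abs_lt_one c (by rw [abs_of_nonneg (by norm_num)]; norm_num)
  have h2 : Tendsto (fun h : ℕ => (1 / 2 : ℝ) ^ h) atTop (𝓝 0) :=
    tendsto_pow_atTop_nhds_zero_of_lt_one (by norm_num) (by norm_num)
  have h3 : Tendsto (fun h : ℕ => (5 * 2 ^ c * (h : ℝ) ^ c + 5 * c) * (1 / 2 : ℝ) ^ h) atTop (𝓝 0) := by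
    have := (h1.const_mul (5 * (2 : ℝ) ^ c)).add (h2.const_mul (5 * (c : ℝ)))
    rw [mul_zero, mul_zero, add_zero] at this
    refine this.congr fun h => ?_
    ring
  obtain ⟨H, hH⟩ := eventually_atTop.1 (h3.eventually_lt_const zero_lt_one)
  exact ⟨H, hH⟩

/-! ### The kill -/

end Main

end NoFreeFrameKill

/-! ### The named fact -/

section Fact

open NoFreeFrameKill

/-- **`noFreeFrame` — DISCHARGED (`¬ H_FF`)**: no uniform bound `1/poly` on the frame-minimised linear-cut purity holds
for the witness family `cubeFamily` (loading `Σ_y |y⟩`, computing `y ↦ y³` in `𝔽₂[X]/(Φ_{3^{k+1}})` with Toffoli/CNOT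
gates, input `0ⁿ`, final stage): by `cubeGraphFlat_holds` and the ancilla-free purity bound every Clifford frame has a
linear cut of purity `≤ 5·2^{−n/2}`. [cite: LiuClark2024] [cite: AaronsonGottesman2004] -/
theorem noFreeFrame_holds : noFreeFrame := by
  intro hFF
  obtain ⟨c, hc⟩ := hFF cubeFamily cubeFamily_isOracleFree cubeFamily_isUniform
  -- choose the input length `n = 2h`, `h = 3^H` with `H` from the asymptotics
  obtain ⟨H, hH⟩ := eventually_small c
  set h : ℕ := 3 ^ H with hh
  have hHh : H ≤ h := (Nat.lt_pow_self (by norm_num : 1 < 3)).le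
  have hsmall := hH h hHh
  set x : List Bool := List.replicate (2 * h) false with hxdef
  have hxlen : x.length = 2 * 3 ^ H := List.length_replicate
  have hx0 : ∀ i, x.get i = false := replicate_get (2 * h)
  have hxpos : 0 < x.length := by rw [hxlen]; positivity
  obtain ⟨U, hU, hcl, hbound⟩ := hc x (cubeGates x.length).length
  -- the route's purity sum is `puritySum`; take the cut `h`
  have hcut : h ≤ x.length + x.length := by rw [hxlen]; omega
  have hb := hbound h hcut
  change (1 : ℝ) / (x.length ^ c + c) ≤ ‖puritySum h (U.mulVec (cubeFamily.stateAfter x (cubeGates x.length).length))‖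
    at hb
  -- the state, its norm and its flatness
  rw [cubeFamily_stateAfter x hx0 hxpos] at hb
  have hnorm := normSq_graphState (cubeMap x.length)
  have hflat := pauliExp_cubeState_le H x.length hxlen
  have hpur := norm_puritySum_mulVec_le hnorm hflat hU hcl hcut
  -- numerics: the bound is `5 · (1/2)^h`
  have hval : (2 : ℝ)⁻¹ ^ h + 2 ^ h * ((1 / 2 : ℝ) ^ x.length * (2 * Real.sqrt 2 ^ x.length)) ^ 2 =
      5 * (1 / 2 : ℝ) ^ h := by
    rw [hxlen, ← hh, pow_mul (Real.sqrt 2) 2 h, Real.sq_sqrt (by norm_num : (0 : ℝ) ≤ 2), one_div, inv_pow,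
      inv_pow, pow_mul' (2 : ℝ) 2 h]
    have h2 : (0 : ℝ) < 2 ^ h := by positivity
    field_simp
    ring
  rw [hval] at hpur
  have hle := hb.trans hpur
  -- contradiction with the asymptotics
  rw [hxlen, ← hh] at hle
  have hden : (0 : ℝ) < ((2 * h : ℕ) : ℝ) ^ c + c := by positivity
  rw [div_le_iff₀ hden] at hle
  have : (5 * 2 ^ c * (h : ℝ) ^ c + 5 * c) * (1 / 2 : ℝ) ^ h = 5 * (1 / 2 : ℝ) ^ h * (((2 * h : ℕ) : ℝ) ^ c + c) := by
    push_cast; ring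
  linarith

end Fact

end Literature.Barriers.QuantumAdvantage

end
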